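import Literature.Probability.RandomPlanarGeometry.SAWPulledLargeForceExpansionZdThreeSlackTwo
import HarnessLib

/-!
# The pulled self-avoiding walk on `ℤ^{d+1}` at large force: the four-slack layer at span two (`N_{8,10}`), structure half

Topic `Literature/Probability/RandomPlanarGeometry` (same method as `SAWPulledLargeForceExpansionZdThreeSlackTwo.lean`, one step longer).

THE LAYER `N_{8,10}`. An irreducible bridge of `ℤ^{d+1}` of length ten and cost eight has span two; heights after the start live in `{1, 2}`,
no up-step is followed at once by a down-step nor conversely (tree `…ZdHeights`), a monotone profile is reducible. Two shapes survive:
(A) three up-steps, one down-step and SIX transverse steps — the thirty-five height words `U T^a U T^b D T^c U T^e`, `a + b + c + e = 6`,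
`b, c ≥ 1`, coded by the vertical times `(p, q, r)` — and (B) four up-steps, two down-steps and FOUR transverse steps — the single word
`U U T D T U T D T U`. In shape (A) the bridge is the table-driven walk `walk v u` of its six transverse steps; in shape (B) it is `walkB w`
of its four transverse steps, and `walkB w` is self-avoiding iff `w` is a four-step self-avoiding walk of the transverse lattice
(`fiveStepIndex`). Hence ★ `N_{8,10}(ℤ^{d+1}) = Σ_{v ∈ verts} #adm(v) + c₄(ℤ^d)` — the layer reduced to thirty-five fibres (their
census, twenty-three constraint classes on six letters, is the sequel; lane data: `N_{8,10}(ℤ², ℤ³, ℤ⁴) = 102, 35 484, 698 658`).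
Not in print (lane «pcv-sawmu»).

## Contents (namespace `Literature.Probability.RandomPlanarGeometry.SAW.Zd.FourSlackTwo`; all PROVED, standard axioms, no data)
shape (A): `IsVert`, `ht`, `tau`, `psum6`, `walk`, generic `walk_adj/_isBridge/_not_renewal/_mem_filter/_injective`, `verts_eq_of_eq`,
`walk_mem_saws_iff` (self-avoidance = block condition `Good`), `adm`; shape (B): `htB`, `tauB`, `walkB`, `walkB_mem_saws_iff`;
the converse ★ `exists_params_of_mem`; ★★ `costCoeffZd_eight_ten_eq_sum`.
Provenance: lane «pcv-sawmu», a-p3 g18 (2026-08-25). [cite: MadrasSlade1993, §4.2, remark after Theorem 4.2.4 (p. 94)]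
[cite: DuminilCopinHammond2013, §2.2]
-/

noncomputable section

open Finset
open scoped BigOperators
open Literature.Probability.LatticeModels
open Literature.Probability.RandomPlanarGeometry.SAW

namespace Literature.Probability.RandomPlanarGeometry.SAW.Zd

namespace FourSlackTwo

/-! ### Vertical times, heights and the transverse clock -/

/-- Admissible vertical times `(p, q, r)` of a ten-step walk with height word `U T^a U T^b D T^c U T^e` (`a+b+c+e = 6`), `b, c ≥ 1`:
the up-steps are at times `0, p, r`, the down-step at time `q`, `1 ≤ p`, `p + 2 ≤ q`, `q + 2 ≤ r ≤ 9`.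
[cite: MadrasSlade1993, §4.2, remark after Theorem 4.2.4 (p. 94)] -/
def IsVert (v : ℕ × ℕ × ℕ) : Prop := 1 ≤ v.1 ∧ v.1 + 2 ≤ v.2.1 ∧ v.2.1 + 2 ≤ v.2.2 ∧ v.2.2 ≤ 9

/-- `IsVert` is decidable. [cite: MadrasSlade1993, §4.2, remark after Theorem 4.2.4 (p. 94)] -/
instance : DecidablePred IsVert := fun v => by unfold IsVert; infer_instance

/-- The height at time `t`: `0, 1 (t ≤ p), 2 (t ≤ q), 1 (t ≤ r), 2`. [cite: MadrasSlade1993, §4.2, remark after Theorem 4.2.4 (p. 94)] -/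
def ht (v : ℕ × ℕ × ℕ) (t : ℕ) : ℕ :=
  if t = 0 then 0 else if t ≤ v.1 then 1 else if t ≤ v.2.1 then 2 else if t ≤ v.2.2 then 1 else 2

/-- The number of transverse steps taken before time `t`. [cite: MadrasSlade1993, §4.2, remark after Theorem 4.2.4 (p. 94)] -/
def tau (v : ℕ × ℕ × ℕ) (t : ℕ) : ℕ :=
  if t = 0 then 0 else if t ≤ v.1 then t - 1 else if t ≤ v.2.1 then t - 2 else if t ≤ v.2.2 then t - 3 else t - 4

/-- The vertical times (including the initial up-step at time `0`). [cite: MadrasSlade1993, §4.2, remark after Theorem 4.2.4 (p. 94)] -/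
def IsVTime (v : ℕ × ℕ × ℕ) (t : ℕ) : Prop := t = 0 ∨ t = v.1 ∨ t = v.2.1 ∨ t = v.2.2

/-- `IsVTime` is decidable. [cite: MadrasSlade1993, §4.2, remark after Theorem 4.2.4 (p. 94)] -/
instance (v : ℕ × ℕ × ℕ) : DecidablePred (IsVTime v) := fun t => by unfold IsVTime; infer_instance

section clock

variable {v : ℕ × ℕ × ℕ}

/-- A transverse (flat) time: the clock advances, the height stays. [cite: MadrasSlade1993, §4.2, remark after Theorem 4.2.4 (p. 94)] -/
theorem tau_succ_of_flat (hv : IsVert v) {t : ℕ} (ht9 : t < 10) (hft : ¬ IsVTime v t) :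
    tau v (t + 1) = tau v t + 1 ∧ ht v (t + 1) = ht v t ∧ tau v t ≤ 5 := by
  obtain ⟨h1, h2, h3, h4⟩ := hv
  simp only [IsVTime, not_or] at hft
  obtain ⟨f0, fp, fq, fr⟩ := hft
  refine ⟨?_, ?_, ?_⟩
  · simp only [tau]; split_ifs <;> first | contradiction | omega
  · simp only [ht]; split_ifs <;> first | contradiction | omega
  · simp only [tau]; split_ifs <;> first | contradiction | omega

/-- An up time (`0`, `p`, `r`): the clock stays, the height goes up. [cite: MadrasSlade1993, §4.2, remark after Theorem 4.2.4 (p. 94)] -/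
theorem tau_succ_of_up (hv : IsVert v) {t : ℕ} (hup : t = 0 ∨ t = v.1 ∨ t = v.2.2) :
    tau v (t + 1) = tau v t ∧ ht v (t + 1) = ht v t + 1 := by
  obtain ⟨h1, h2, h3, h4⟩ := hv
  have ht' : t = 0 ∨ t = v.1 ∨ t = v.2.2 := hup
  refine ⟨?_, ?_⟩
  · simp only [tau]; split_ifs <;> first | contradiction | omega
  · simp only [ht]; split_ifs <;> first | contradiction | omega

/-- The down time `q`: the clock stays, the height goes down. [cite: MadrasSlade1993, §4.2, remark after Theorem 4.2.4 (p. 94)] -/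
theorem tau_succ_of_down (hv : IsVert v) {t : ℕ} (hdn : t = v.2.1) :
    tau v (t + 1) = tau v t ∧ ht v (t + 1) + 1 = ht v t := by
  obtain ⟨h1, h2, h3, h4⟩ := hv
  refine ⟨?_, ?_⟩
  · simp only [tau]; split_ifs <;> first | contradiction | omega
  · simp only [ht]; split_ifs <;> first | contradiction | omega

/-- Values at the two ends and the ranges. [cite: MadrasSlade1993, §4.2, remark after Theorem 4.2.4 (p. 94)] -/
theorem clock_bounds (hv : IsVert v) (t : ℕ) :
    tau v 0 = 0 ∧ ht v 0 = 0 ∧ tau v 10 = 6 ∧ ht v 10 = 2 ∧ (1 ≤ t → 1 ≤ ht v t ∧ ht v t ≤ 2) ∧ (t ≤ 10 → tau v t ≤ 6) := by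
  obtain ⟨h1, h2, h3, h4⟩ := hv
  refine ⟨by simp [tau], by simp [ht], ?_, ?_, fun ht1 => ⟨?_, ?_⟩, fun _ => ?_⟩
  · simp only [tau]; split_ifs <;> first | contradiction | omega
  · simp only [ht]; split_ifs <;> first | contradiction | omega
  · simp only [ht]; split_ifs <;> first | contradiction | omega
  · simp only [ht]; split_ifs <;> first | contradiction | omega
  · simp only [tau]; split_ifs <;> first | contradiction | omega

/-- The clock is non-decreasing. [cite: MadrasSlade1993, §4.2, remark after Theorem 4.2.4 (p. 94)] -/
theorem tau_mono (hv : IsVert v) {s t : ℕ} (hst : s ≤ t) : tau v s ≤ tau v t := by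
  obtain ⟨h1, h2, h3, h4⟩ := hv
  simp only [tau]
  split_ifs <;> first | contradiction | omega

/-- Two distinct times `s < t ≤ 10` with the same clock value have different heights. [cite: MadrasSlade1993, §4.2, remark after Theorem 4.2.4 (p. 94)] -/
theorem ht_ne_of_tau_eq (hv : IsVert v) {s t : ℕ} (hst : s < t) (ht9 : t ≤ 10) (he : tau v s = tau v t) : ht v s ≠ ht v t := by
  obtain ⟨h1, h2, h3, h4⟩ := hv
  simp only [tau, ht] at he ⊢
  split_ifs at he ⊢ <;> first | contradiction | omega

/-- Every clock value `i ≤ tau v t` is attained at some time `≤ t`, with any prescribed compatible height: more precisely, for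
`i < j ≤ 6` and two times `s < t ≤ 10` … (discrete intermediate values). We only need: each `m ≤ 5` is the clock value of a flat time.
[cite: MadrasSlade1993, §4.2, remark after Theorem 4.2.4 (p. 94)] -/
theorem exists_flat_of_lt_six (hv : IsVert v) {m : ℕ} (hm : m ≤ 5) : ∃ t, t < 10 ∧ ¬ IsVTime v t ∧ tau v t = m := by
  obtain ⟨h1, h2, h3, h4⟩ := hv
  -- the flat times are `[1, p-1] ∪ [p+1, q-1] ∪ [q+1, r-1] ∪ [r+1, 9]`, with clock values `0 … 5` in order
  by_cases hm1 : m + 2 ≤ v.1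
  · refine ⟨m + 1, by omega, by rintro (h | h | h | h) <;> omega, ?_⟩
    simp only [tau]; split_ifs <;> first | contradiction | omega
  by_cases hm2 : m + 3 ≤ v.2.1
  · refine ⟨m + 2, by omega, by rintro (h | h | h | h) <;> omega, ?_⟩
    simp only [tau]; split_ifs <;> first | contradiction | omega
  by_cases hm3 : m + 4 ≤ v.2.2
  · refine ⟨m + 3, by omega, by rintro (h | h | h | h) <;> omega, ?_⟩
    simp only [tau]; split_ifs <;> first | contradiction | omega
  · refine ⟨m + 4, by omega, by rintro (h | h | h | h) <;> omega, ?_⟩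
    simp only [tau]; split_ifs <;> first | contradiction | omega

end clock

/-! ### Transverse data and the table-driven walks -/

/-- Six transverse step indices (a word of length six). [cite: MadrasSlade1993, Definition 1.2.4] -/
abbrev W6 (d : ℕ) := Idx d × Idx5 d

/-- The partial sums `0, u₁, u₁+u₂, …, u₁+⋯+u₆` (frozen from `6`). [cite: MadrasSlade1993, Definition 1.2.4] -/
def psum6 (d : ℕ) (u : W6 d) : ℕ → Site (d + 1)
  | 0 => 0
  | 1 => twoStepV d u.1
  | 2 => twoStepV d u.1 + twoStepV d u.2.1
  | 3 => twoStepV d u.1 + twoStepV d u.2.1 + twoStepV d u.2.2.1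
  | 4 => twoStepV d u.1 + twoStepV d u.2.1 + twoStepV d u.2.2.1 + twoStepV d u.2.2.2.1
  | 5 => twoStepV d u.1 + twoStepV d u.2.1 + twoStepV d u.2.2.1 + twoStepV d u.2.2.2.1 + twoStepV d u.2.2.2.2.1
  | _ + 6 => twoStepV d u.1 + twoStepV d u.2.1 + twoStepV d u.2.2.1 + twoStepV d u.2.2.2.1 + twoStepV d u.2.2.2.2.1 +
      twoStepV d u.2.2.2.2.2

/-- `psum6` has no `e₀`-component. [cite: MadrasSlade1993, Definition 1.2.4] -/
@[simp] theorem psum6_apply_zero (d : ℕ) (u : W6 d) : ∀ m, psum6 d u m 0 = 0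
  | 0 => rfl
  | 1 => by simp [psum6]
  | 2 => by simp [psum6]
  | 3 => by simp [psum6]
  | 4 => by simp [psum6]
  | 5 => by simp [psum6]
  | _ + 6 => by simp [psum6]

/-- The `m`-th transverse step (`m = 0, …, 5`). [cite: MadrasSlade1993, Definition 1.2.4] -/
def nth6 (d : ℕ) (u : W6 d) (m : ℕ) : Idx d :=
  if m = 0 then u.1 else if m = 1 then u.2.1 else if m = 2 then u.2.2.1 else if m = 3 then u.2.2.2.1 else if m = 4 then u.2.2.2.2.1
  else u.2.2.2.2.2

/-- `psum6 (m+1) = psum6 m + u_{m+1}` for `m ≤ 5`. [cite: MadrasSlade1993, Definition 1.2.4] -/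
theorem psum6_succ (d : ℕ) (u : W6 d) {m : ℕ} (hm : m ≤ 5) : psum6 d u (m + 1) = psum6 d u m + twoStepV d (nth6 d u m) := by
  interval_cases m <;> simp [psum6, nth6]

/-- `psum6` is frozen from `6`. [cite: MadrasSlade1993, Definition 1.2.4] -/
theorem psum6_of_six_le (d : ℕ) (u : W6 d) {m : ℕ} (hm : 6 ≤ m) : psum6 d u m = psum6 d u 6 := by
  obtain ⟨k, rfl⟩ : ∃ k, m = k + 6 := ⟨m - 6, by omega⟩
  rfl

/-- ★ The table-driven walk with vertical times `v` and transverse steps `u` (frozen from time `10`).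
[cite: MadrasSlade1993, §4.2, remark after Theorem 4.2.4 (p. 94)] -/
def walk (d : ℕ) (v : ℕ × ℕ × ℕ) (u : W6 d) (t : ℕ) : Site (d + 1) :=
  Pi.single 0 (ht v (min t 10) : ℤ) + psum6 d u (tau v (min t 10))

section generic

variable {d : ℕ} {v : ℕ × ℕ × ℕ}

/-- Heights along `walk`. [cite: MadrasSlade1993, §4.2, remark after Theorem 4.2.4 (p. 94)] -/
theorem walk_apply_zero (v : ℕ × ℕ × ℕ) (u : W6 d) (t : ℕ) : walk d v u t 0 = ht v (min t 10) := by
  simp [walk]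

/-- `walk` is frozen from `10`. [cite: MadrasSlade1993, §4.2, remark after Theorem 4.2.4 (p. 94)] -/
theorem walk_of_le (v : ℕ × ℕ × ℕ) (u : W6 d) {t : ℕ} (ht9 : 10 ≤ t) : walk d v u t = walk d v u 10 := by
  simp only [walk, min_eq_right ht9, min_self]

/-- `x ↦ x + e₀` is a lattice step. [cite: MadrasSlade1993, Definition 1.2.4] -/
private theorem adj_add_e0' (d : ℕ) (x : Site (d + 1)) : (zdGraph (d + 1)).Adj x (x + Pi.single 0 1) := by
  rw [zdGraph_adj_iff]; exact ⟨0, Or.inl rfl⟩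

/-- A flat step of `walk`. [cite: MadrasSlade1993, Definition 1.2.4] -/
theorem walk_succ_of_flat (hv : IsVert v) (u : W6 d) {t : ℕ} (ht9 : t < 10) (hft : ¬ IsVTime v t) :
    walk d v u (t + 1) = walk d v u t + twoStepV d (nth6 d u (tau v t)) := by
  obtain ⟨e1, e2, e3⟩ := tau_succ_of_flat hv ht9 hft
  rw [walk, walk, min_eq_left ht9.le, min_eq_left (by omega : t + 1 ≤ 10), e1, e2, psum6_succ d u e3]; abel

/-- An up step of `walk`. [cite: MadrasSlade1993, Definition 1.2.4] -/
theorem walk_succ_of_up (hv : IsVert v) (u : W6 d) {t : ℕ} (hup : t = 0 ∨ t = v.1 ∨ t = v.2.2) :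
    walk d v u (t + 1) = walk d v u t + Pi.single 0 1 := by
  have ht9 : t < 10 := by obtain ⟨h1, h2, h3, h4⟩ := hv; rcases hup with rfl | rfl | rfl <;> omega
  obtain ⟨e1, e2⟩ := tau_succ_of_up hv hup
  rw [walk, walk, min_eq_left ht9.le, min_eq_left (by omega : t + 1 ≤ 10), e1, e2, Nat.cast_add, Nat.cast_one, Pi.single_add]; abel

/-- The down step of `walk`. [cite: MadrasSlade1993, Definition 1.2.4] -/
theorem walk_succ_of_down (hv : IsVert v) (u : W6 d) {t : ℕ} (hdn : t = v.2.1) :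
    walk d v u (t + 1) = walk d v u t - Pi.single 0 1 := by
  have ht9 : t < 10 := by obtain ⟨h1, h2, h3, h4⟩ := hv; omega
  obtain ⟨e1, e2⟩ := tau_succ_of_down hv hdn
  rw [walk, walk, min_eq_left ht9.le, min_eq_left (by omega : t + 1 ≤ 10), e1, ← e2, Nat.cast_add, Nat.cast_one, Pi.single_add]
  abel

/-- Consecutive sites of `walk` are lattice neighbours. [cite: MadrasSlade1993, Definition 1.2.4] -/
theorem walk_adj (hv : IsVert v) (u : W6 d) {t : ℕ} (ht9 : t < 10) : (zdGraph (d + 1)).Adj (walk d v u t) (walk d v u (t + 1)) := by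
  by_cases hft : IsVTime v t
  · rcases hft with h | h | h | h
    · rw [walk_succ_of_up hv u (Or.inl h)]; exact adj_add_e0' d _
    · rw [walk_succ_of_up hv u (Or.inr (Or.inl h))]; exact adj_add_e0' d _
    · have e := walk_succ_of_down hv u h
      rw [show walk d v u t = walk d v u (t + 1) + Pi.single 0 1 by rw [e]; abel]
      exact (adj_add_e0' d _).symm
    · rw [walk_succ_of_up hv u (Or.inr (Or.inr h))]; exact adj_add_e0' d _
  · rw [walk_succ_of_flat hv u ht9 hft]; exact adj_add_twoStepV d _ _

/-- `walk` is a bridge of span two. [cite: MadrasSlade1993, §4.2, remark after Theorem 4.2.4 (p. 94)] -/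
theorem walk_isBridge (hv : IsVert v) (u : W6 d) : IsBridge 10 (walk d v u) := by
  intro i hi1 hi9
  rw [walk_apply_zero, walk_apply_zero, walk_apply_zero, min_eq_left hi9, Nat.zero_min, min_self]
  obtain ⟨-, h0, -, h9, hr, -⟩ := clock_bounds hv i
  obtain ⟨h1', h2'⟩ := hr hi1
  rw [h0, h9]
  exact ⟨by exact_mod_cast h1', by exact_mod_cast h2'⟩

/-- The height table on its four runs. [cite: MadrasSlade1993, §4.2, remark after Theorem 4.2.4 (p. 94)] -/
theorem ht_runs (hv : IsVert v) :
    (∀ k, 1 ≤ k → k ≤ v.1 → ht v k = 1) ∧ (∀ k, v.1 < k → k ≤ v.2.1 → ht v k = 2) ∧ (∀ k, v.2.1 < k → k ≤ v.2.2 → ht v k = 1) ∧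
      (∀ k, v.2.2 < k → ht v k = 2) := by
  obtain ⟨h1, h2, h3, h4⟩ := hv
  refine ⟨fun k hk1 hk2 => ?_, fun k hk1 hk2 => ?_, fun k hk1 hk2 => ?_, fun k hk1 => ?_⟩ <;> simp only [ht] <;> split_ifs <;> omega

/-- `walk` has no renewal time in `[1, 9]`: at a time of height `2` the end is not higher; at a time of height `1` either a later
time has height `1` or an earlier time has height `2`. [cite: DuminilCopinHammond2013, §2.2] -/
theorem walk_not_renewal (hv : IsVert v) (u : W6 d) {k : ℕ} (hk1 : 1 ≤ k) (hk8 : k ≤ 10 - 1) : ¬ IsRenewalTime 10 (walk d v u) k := by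
  rintro ⟨-, hb1, hb2⟩
  have hle : ∀ i, 1 ≤ i → i ≤ k → ht v i ≤ ht v k := by
    intro i hi1 hi2
    have := (hb1 i hi1 hi2).2
    rw [walk_apply_zero, walk_apply_zero, min_eq_left (by omega : i ≤ 10), min_eq_left (by omega : k ≤ 10)] at this
    exact_mod_cast this
  have hgt : ∀ j, 1 ≤ j → j ≤ 10 - k → ht v k < ht v (k + j) := by
    intro j hj1 hj2
    have := (hb2 j hj1 hj2).1
    simp only [add_zero] at this
    rw [walk_apply_zero, walk_apply_zero, min_eq_left (by omega : k ≤ 10), min_eq_left (by omega : k + j ≤ 10)] at this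
    exact_mod_cast this
  obtain ⟨h1, h2, h3, h4⟩ := hv
  obtain ⟨r1, r2, r3, r4⟩ := ht_runs ⟨h1, h2, h3, h4⟩
  have e9 := hgt (10 - k) (by omega) le_rfl
  rw [show k + (10 - k) = 10 by omega, r4 10 (by omega)] at e9
  -- so `ht v k = 1`: `k ≤ p` or `q < k ≤ r`
  by_cases hkp : k ≤ v.1
  · -- the later time `r` has height `1`
    have := hgt (v.2.2 - k) (by omega) (by omega)
    rw [show k + (v.2.2 - k) = v.2.2 by omega, r3 v.2.2 (by omega) le_rfl, r1 k hk1 hkp] at this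
    exact lt_irrefl _ this
  · by_cases hkq : k ≤ v.2.1
    · rw [r2 k (by omega) hkq] at e9; exact lt_irrefl _ e9
    · by_cases hkr : k ≤ v.2.2
      · -- the earlier time `p + 1` has height `2`
        have := hle (v.1 + 1) (by omega) (by omega)
        rw [r2 (v.1 + 1) (by omega) (by omega), r3 k (by omega) hkr] at this
        omega
      · rw [r4 k (by omega)] at e9; exact lt_irrefl _ e9

/-- Self-avoiding members of the family are irreducible bridges of cost eight. [cite: DuminilCopinHammond2013, §2.2] -/
theorem walk_mem_filter (hv : IsVert v) {u : W6 d} (hu : walk d v u ∈ saws (d + 1) 10) :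
    walk d v u ∈ (irreducibleBridges (d + 1) 10).filter fun ω => costZd d 10 ω = 8 := by
  refine Finset.mem_filter.2 ⟨mem_irreducibleBridges.2 ⟨mem_bridges.2 ⟨hu, walk_isBridge hv u⟩,
    ⟨by omega, walk_isBridge hv u, fun k hk1 hk2 => walk_not_renewal hv u hk1 hk2⟩⟩, ?_⟩
  rw [costZd, walk_apply_zero, min_self, (clock_bounds hv 0).2.2.2.1]
  rfl

/-- The flat times of `walk` are exactly the non-vertical times. [cite: MadrasSlade1993, §4.2, remark after Theorem 4.2.4 (p. 94)] -/
theorem walk_flat_iff (hv : IsVert v) (u : W6 d) {t : ℕ} (ht9 : t < 10) :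
    walk d v u (t + 1) 0 = walk d v u t 0 ↔ ¬ IsVTime v t := by
  rw [walk_apply_zero, walk_apply_zero, min_eq_left (by omega : t + 1 ≤ 10), min_eq_left ht9.le]
  constructor
  · intro h hvt
    rcases hvt with h' | h' | h' | h'
    · have := (tau_succ_of_up hv (Or.inl h')).2; rw [this] at h; push_cast at h; linarith
    · have := (tau_succ_of_up hv (Or.inr (Or.inl h'))).2; rw [this] at h; push_cast at h; linarith
    · have := (tau_succ_of_down hv h').2; rw [← this] at h; push_cast at h; linarith
    · have := (tau_succ_of_up hv (Or.inr (Or.inr h'))).2; rw [this] at h; push_cast at h; linarith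
  · intro hft; rw [(tau_succ_of_flat hv ht9 hft).2.1]

/-- `walk d v` is injective in the transverse data. [cite: MadrasSlade1993, Definition 1.2.4] -/
theorem walk_injective (hv : IsVert v) : Function.Injective (walk d v) := by
  intro u u' h
  have key : ∀ m, m ≤ 5 → twoStepV d (nth6 d u m) = twoStepV d (nth6 d u' m) := by
    intro m hm
    obtain ⟨t, ht9, hft, htm⟩ := exists_flat_of_lt_six hv hm
    have e1 := walk_succ_of_flat hv u ht9 hft
    have e2 := walk_succ_of_flat hv u' ht9 hft
    rw [h] at e1
    rw [htm] at e1 e2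
    exact add_left_cancel (e1.symm.trans e2)
  have k0 := key 0 (by norm_num); have k1 := key 1 (by norm_num); have k2 := key 2 (by norm_num)
  have k3 := key 3 (by norm_num); have k4 := key 4 (by norm_num); have k5 := key 5 (by norm_num)
  obtain ⟨u1, u2, u3, u4, u5, u6⟩ := u; obtain ⟨w1, w2, w3, w4, w5, w6⟩ := u'
  simp only [nth6] at k0 k1 k2 k3 k4 k5
  norm_num at k0 k1 k2 k3 k4 k5
  rw [twoStepV_injective d k0, twoStepV_injective d k1, twoStepV_injective d k2, twoStepV_injective d k3, twoStepV_injective d k4,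
    twoStepV_injective d k5]

/-- Two members of table-driven families that coincide have the same vertical times. [cite: MadrasSlade1993, §4.2, remark after Theorem 4.2.4 (p. 94)] -/
theorem verts_eq_of_eq {v v' : ℕ × ℕ × ℕ} (hv : IsVert v) (hv' : IsVert v') {u u' : W6 d} (h : walk d v u = walk d v' u') : v = v' := by
  have key : ∀ t, t < 10 → (IsVTime v t ↔ IsVTime v' t) := by
    intro t ht9
    have h2 : (walk d v u (t + 1) 0 = walk d v u t 0 ↔ ¬ IsVTime v' t) := by rw [h]; exact walk_flat_iff hv' u' ht9
    exact not_iff_not.1 ((walk_flat_iff hv u ht9).symm.trans h2)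
  obtain ⟨p, q, r⟩ := v
  obtain ⟨p', q', r'⟩ := v'
  obtain ⟨h1, h2, h3, h4⟩ := hv
  obtain ⟨h1', h2', h3', h4'⟩ := hv'
  simp only [IsVTime] at key h1 h2 h3 h4 h1' h2' h3' h4' ⊢
  have kp := (key p (by omega)).1 (by omega)
  have kq := (key q (by omega)).1 (by omega)
  have kr := (key r (by omega)).1 (by omega)
  have kp' := (key p' (by omega)).2 (by omega)
  have kq' := (key q' (by omega)).2 (by omega)
  have kr' := (key r' (by omega)).2 (by omega)
  simp only [Prod.mk.injEq]
  omega

end generic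
/-! ### Four transverse unit steps summing to zero -/

/-- ★ Six transverse unit steps sum to zero iff they cancel in three pairs (fifteen matchings; for the fibre census of the sequel).
[cite: MadrasSlade1993, Definition 1.2.4] -/
theorem sum_six_eq_zero_iff (d : ℕ) (a b c e f g : Idx d) :
    twoStepV d a + twoStepV d b + twoStepV d c + twoStepV d e + twoStepV d f + twoStepV d g = 0 ↔
      (b = revIdx a ∧ e = revIdx c ∧ g = revIdx f) ∨
      (b = revIdx a ∧ f = revIdx c ∧ g = revIdx e) ∨
      (b = revIdx a ∧ g = revIdx c ∧ f = revIdx e) ∨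
      (c = revIdx a ∧ e = revIdx b ∧ g = revIdx f) ∨
      (c = revIdx a ∧ f = revIdx b ∧ g = revIdx e) ∨
      (c = revIdx a ∧ g = revIdx b ∧ f = revIdx e) ∨
      (e = revIdx a ∧ c = revIdx b ∧ g = revIdx f) ∨
      (e = revIdx a ∧ f = revIdx b ∧ g = revIdx c) ∨
      (e = revIdx a ∧ g = revIdx b ∧ f = revIdx c) ∨
      (f = revIdx a ∧ c = revIdx b ∧ g = revIdx e) ∨
      (f = revIdx a ∧ e = revIdx b ∧ g = revIdx c) ∨
      (f = revIdx a ∧ g = revIdx b ∧ e = revIdx c) ∨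
      (g = revIdx a ∧ c = revIdx b ∧ f = revIdx e) ∨
      (g = revIdx a ∧ e = revIdx b ∧ f = revIdx c) ∨
      (g = revIdx a ∧ f = revIdx b ∧ e = revIdx c) := by
  constructor
  · intro h
    rcases exists_eq_revIdx_of_sum_six_eq_zero d h with hx | hx | hx | hx | hx
    · have h4 : twoStepV d c + twoStepV d e + twoStepV d f + twoStepV d g = 0 := by
        rw [hx, twoStepV_revIdx] at h; rw [← h]; abel
      rcases (ThreeSlackTwo.sum_four_eq_zero_iff d c e f g).1 h4 with ⟨h1, h2⟩ | ⟨h1, h2⟩ | ⟨h1, h2⟩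
      · exact Or.inl ⟨hx, h1, h2⟩
      · exact Or.inr (Or.inl ⟨hx, h1, h2⟩)
      · exact Or.inr (Or.inr (Or.inl ⟨hx, h1, h2⟩))
    · have h4 : twoStepV d b + twoStepV d e + twoStepV d f + twoStepV d g = 0 := by
        rw [hx, twoStepV_revIdx] at h; rw [← h]; abel
      rcases (ThreeSlackTwo.sum_four_eq_zero_iff d b e f g).1 h4 with ⟨h1, h2⟩ | ⟨h1, h2⟩ | ⟨h1, h2⟩
      · exact Or.inr (Or.inr (Or.inr (Or.inl ⟨hx, h1, h2⟩)))
      · exact Or.inr (Or.inr (Or.inr (Or.inr (Or.inl ⟨hx, h1, h2⟩))))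
      · exact Or.inr (Or.inr (Or.inr (Or.inr (Or.inr (Or.inl ⟨hx, h1, h2⟩)))))
    · have h4 : twoStepV d b + twoStepV d c + twoStepV d f + twoStepV d g = 0 := by
        rw [hx, twoStepV_revIdx] at h; rw [← h]; abel
      rcases (ThreeSlackTwo.sum_four_eq_zero_iff d b c f g).1 h4 with ⟨h1, h2⟩ | ⟨h1, h2⟩ | ⟨h1, h2⟩
      · exact Or.inr (Or.inr (Or.inr (Or.inr (Or.inr (Or.inr (Or.inl ⟨hx, h1, h2⟩))))))
      · exact Or.inr (Or.inr (Or.inr (Or.inr (Or.inr (Or.inr (Or.inr (Or.inl ⟨hx, h1, h2⟩)))))))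
      · exact Or.inr (Or.inr (Or.inr (Or.inr (Or.inr (Or.inr (Or.inr (Or.inr (Or.inl ⟨hx, h1, h2⟩))))))))
    · have h4 : twoStepV d b + twoStepV d c + twoStepV d e + twoStepV d g = 0 := by
        rw [hx, twoStepV_revIdx] at h; rw [← h]; abel
      rcases (ThreeSlackTwo.sum_four_eq_zero_iff d b c e g).1 h4 with ⟨h1, h2⟩ | ⟨h1, h2⟩ | ⟨h1, h2⟩
      · exact Or.inr (Or.inr (Or.inr (Or.inr (Or.inr (Or.inr (Or.inr (Or.inr (Or.inr (Or.inl ⟨hx, h1, h2⟩)))))))))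
      · exact Or.inr (Or.inr (Or.inr (Or.inr (Or.inr (Or.inr (Or.inr (Or.inr (Or.inr (Or.inr (Or.inl ⟨hx, h1, h2⟩))))))))))
      · exact Or.inr (Or.inr (Or.inr (Or.inr (Or.inr (Or.inr (Or.inr (Or.inr (Or.inr (Or.inr (Or.inr (Or.inl ⟨hx, h1, h2⟩)))))))))))
    · have h4 : twoStepV d b + twoStepV d c + twoStepV d e + twoStepV d f = 0 := by
        rw [hx, twoStepV_revIdx] at h; rw [← h]; abel
      rcases (ThreeSlackTwo.sum_four_eq_zero_iff d b c e f).1 h4 with ⟨h1, h2⟩ | ⟨h1, h2⟩ | ⟨h1, h2⟩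
      · exact Or.inr (Or.inr (Or.inr (Or.inr (Or.inr (Or.inr (Or.inr (Or.inr (Or.inr (Or.inr (Or.inr (Or.inr (Or.inl ⟨hx, h1, h2⟩))))))))))))
      · exact Or.inr (Or.inr (Or.inr (Or.inr (Or.inr (Or.inr (Or.inr (Or.inr (Or.inr (Or.inr (Or.inr (Or.inr (Or.inr (Or.inl ⟨hx, h1, h2⟩)))))))))))))
      · exact Or.inr (Or.inr (Or.inr (Or.inr (Or.inr (Or.inr (Or.inr (Or.inr (Or.inr (Or.inr (Or.inr (Or.inr (Or.inr (Or.inr (⟨hx, h1, h2⟩))))))))))))))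
  · rintro (⟨h1, h2, h3⟩ | ⟨h1, h2, h3⟩ | ⟨h1, h2, h3⟩ | ⟨h1, h2, h3⟩ | ⟨h1, h2, h3⟩ | ⟨h1, h2, h3⟩ | ⟨h1, h2, h3⟩ | ⟨h1, h2, h3⟩ | ⟨h1, h2, h3⟩ | ⟨h1, h2, h3⟩ | ⟨h1, h2, h3⟩ | ⟨h1, h2, h3⟩ | ⟨h1, h2, h3⟩ | ⟨h1, h2, h3⟩ | ⟨h1, h2, h3⟩) <;>
      rw [h1, h2, h3, twoStepV_revIdx, twoStepV_revIdx, twoStepV_revIdx] <;> abel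

/-! ### Self-avoidance of the table-driven walks (shape A): a block condition on the transverse steps -/

/-- Do the clock values `i < j` occur at two times of the same height?  (Boolean, by enumeration of the times `≤ 10`.)
[cite: MadrasSlade1993, §4.2, remark after Theorem 4.2.4 (p. 94)] -/
def sameLevel (v : ℕ × ℕ × ℕ) (i j : ℕ) : Bool :=
  (List.range 11).any fun t => (List.range t).any fun s => ht v s == ht v t && tau v s == i && tau v t == j

/-- `sameLevel` from a witness. [cite: MadrasSlade1993, §4.2, remark after Theorem 4.2.4 (p. 94)] -/
theorem sameLevel_of_witness {v : ℕ × ℕ × ℕ} {s t : ℕ} (hst : s < t) (ht9 : t ≤ 10) (hh : ht v s = ht v t) :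
    sameLevel v (tau v s) (tau v t) = true := by
  simp only [sameLevel, List.any_eq_true, List.mem_range, Bool.and_eq_true, beq_iff_eq]
  exact ⟨t, by omega, s, hst, ⟨hh, rfl⟩, rfl⟩

/-- A witness from `sameLevel`. [cite: MadrasSlade1993, §4.2, remark after Theorem 4.2.4 (p. 94)] -/
theorem witness_of_sameLevel {v : ℕ × ℕ × ℕ} {i j : ℕ} (h : sameLevel v i j = true) :
    ∃ s t, s < t ∧ t ≤ 10 ∧ ht v s = ht v t ∧ tau v s = i ∧ tau v t = j := by
  simp only [sameLevel, List.any_eq_true, List.mem_range, Bool.and_eq_true, beq_iff_eq] at h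
  obtain ⟨t, ht10, s, hst, ⟨hh, hs⟩, ht'⟩ := h
  exact ⟨s, t, hst, by omega, hh, hs, ht'⟩

/-- The block condition on the six transverse steps `u = (a, b, c, e, f, g)` prescribed by the vertical times `v`: for each even-gap pair of
clock values flagged by `sameLevel`, the steps between them do not sum to zero. [cite: MadrasSlade1993, §4.2, remark after Theorem 4.2.4 (p. 94)] -/
def Good (d : ℕ) (v : ℕ × ℕ × ℕ) (u : W6 d) : Prop :=
  (sameLevel v 0 2 = true → u.2.1 ≠ revIdx u.1) ∧ (sameLevel v 1 3 = true → u.2.2.1 ≠ revIdx u.2.1) ∧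
  (sameLevel v 2 4 = true → u.2.2.2.1 ≠ revIdx u.2.2.1) ∧ (sameLevel v 3 5 = true → u.2.2.2.2.1 ≠ revIdx u.2.2.2.1) ∧
  (sameLevel v 4 6 = true → u.2.2.2.2.2 ≠ revIdx u.2.2.2.2.1) ∧
  (sameLevel v 0 4 = true → twoStepV d u.1 + twoStepV d u.2.1 + twoStepV d u.2.2.1 + twoStepV d u.2.2.2.1 ≠ 0) ∧
  (sameLevel v 1 5 = true → twoStepV d u.2.1 + twoStepV d u.2.2.1 + twoStepV d u.2.2.2.1 + twoStepV d u.2.2.2.2.1 ≠ 0) ∧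
  (sameLevel v 2 6 = true → twoStepV d u.2.2.1 + twoStepV d u.2.2.2.1 + twoStepV d u.2.2.2.2.1 + twoStepV d u.2.2.2.2.2 ≠ 0) ∧
  (sameLevel v 0 6 = true → twoStepV d u.1 + twoStepV d u.2.1 + twoStepV d u.2.2.1 + twoStepV d u.2.2.2.1 + twoStepV d u.2.2.2.2.1 +
    twoStepV d u.2.2.2.2.2 ≠ 0)

/-- `Good` is decidable. [cite: MadrasSlade1993, §4.2, remark after Theorem 4.2.4 (p. 94)] -/
instance (d : ℕ) (v : ℕ × ℕ × ℕ) : DecidablePred (Good d v) := fun u => by unfold Good; infer_instance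

section selfavoid

variable {d : ℕ} {v : ℕ × ℕ × ℕ}

/-- Two sites of `walk` coincide iff their heights and their transverse partial sums do. [cite: MadrasSlade1993, Definition 1.2.4] -/
theorem walk_eq_iff (u : W6 d) {s t : ℕ} (hs : s ≤ 10) (ht9 : t ≤ 10) :
    walk d v u s = walk d v u t ↔ ht v s = ht v t ∧ psum6 d u (tau v s) = psum6 d u (tau v t) := by
  constructor
  · intro h
    have h0 := congrFun h 0
    rw [walk_apply_zero, walk_apply_zero, min_eq_left hs, min_eq_left ht9] at h0
    have h0' : ht v s = ht v t := by exact_mod_cast h0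
    refine ⟨h0', ?_⟩
    rw [walk, walk, min_eq_left hs, min_eq_left ht9, h0'] at h
    exact add_left_cancel h
  · rintro ⟨h1, h2⟩
    rw [walk, walk, min_eq_left hs, min_eq_left ht9, h1, h2]

/-- The values of `psum6`. [cite: MadrasSlade1993, Definition 1.2.4] -/
theorem psum6_vals (u : W6 d) :
    psum6 d u 0 = 0 ∧ psum6 d u 1 = twoStepV d u.1 ∧ psum6 d u 2 = twoStepV d u.1 + twoStepV d u.2.1 ∧
    psum6 d u 3 = twoStepV d u.1 + twoStepV d u.2.1 + twoStepV d u.2.2.1 ∧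
    psum6 d u 4 = twoStepV d u.1 + twoStepV d u.2.1 + twoStepV d u.2.2.1 + twoStepV d u.2.2.2.1 ∧
    psum6 d u 5 = twoStepV d u.1 + twoStepV d u.2.1 + twoStepV d u.2.2.1 + twoStepV d u.2.2.2.1 + twoStepV d u.2.2.2.2.1 ∧
    psum6 d u 6 = twoStepV d u.1 + twoStepV d u.2.1 + twoStepV d u.2.2.1 + twoStepV d u.2.2.2.1 + twoStepV d u.2.2.2.2.1 +
      twoStepV d u.2.2.2.2.2 :=
  ⟨rfl, rfl, rfl, rfl, rfl, rfl, rfl⟩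

/-- ★ **Self-avoidance of `walk v u` is the block condition `Good v u`.** [cite: MadrasSlade1993, §4.2, remark after Theorem 4.2.4 (p. 94)] -/
theorem walk_mem_saws_iff (hv : IsVert v) (u : W6 d) : walk d v u ∈ saws (d + 1) 10 ↔ Good d v u := by
  obtain ⟨a, b, c, e, f, g⟩ := u
  obtain ⟨p0, p1, p2, p3, p4, p5, p6⟩ := psum6_vals (d := d) (a, b, c, e, f, g)
  simp only at p1 p2 p3 p4 p5 p6
  constructor
  · intro hω
    obtain ⟨-, -, -, hinj⟩ := mem_saws.1 hω
    have key : ∀ i j, sameLevel v i j = true → psum6 d (a, b, c, e, f, g) i ≠ psum6 d (a, b, c, e, f, g) j := by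
      intro i j hij hEq
      obtain ⟨s, t, hst, ht9, hh, rfl, rfl⟩ := witness_of_sameLevel hij
      have := hinj (show s ∈ {k : ℕ | k ≤ 10} from by simp; omega) (show t ∈ {k : ℕ | k ≤ 10} from ht9)
        ((walk_eq_iff (a, b, c, e, f, g) (by omega) ht9).2 ⟨hh, hEq⟩)
      omega
    simp only [Good]
    refine ⟨fun h hba => key 0 2 h ?_, fun h hcb => key 1 3 h ?_, fun h hec => key 2 4 h ?_, fun h hfe => key 3 5 h ?_,
      fun h hgf => key 4 6 h ?_, fun h h4 => key 0 4 h ?_, fun h h4 => key 1 5 h ?_, fun h h4 => key 2 6 h ?_, fun h h6 => key 0 6 h ?_⟩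
    · rw [p0, p2, hba, twoStepV_revIdx]; abel
    · rw [p1, p3, hcb, twoStepV_revIdx]; abel
    · rw [p2, p4, hec, twoStepV_revIdx]; abel
    · rw [p3, p5, hfe, twoStepV_revIdx]; abel
    · rw [p4, p6, hgf, twoStepV_revIdx]; abel
    · rw [p0, p4, h4]
    · rw [p1, p5]
      have e5 : twoStepV d a + twoStepV d b + twoStepV d c + twoStepV d e + twoStepV d f =
          twoStepV d a + (twoStepV d b + twoStepV d c + twoStepV d e + twoStepV d f) := by abel
      rw [e5, h4, add_zero]
    · rw [p2, p6]
      have e6 : twoStepV d a + twoStepV d b + twoStepV d c + twoStepV d e + twoStepV d f + twoStepV d g =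
          twoStepV d a + twoStepV d b + (twoStepV d c + twoStepV d e + twoStepV d f + twoStepV d g) := by abel
      rw [e6, h4, add_zero]
    · rw [p0, p6, h6]
  · intro hg
    simp only [Good] at hg
    obtain ⟨g02, g13, g24, g35, g46, g04, g15, g26, g06⟩ := hg
    refine mem_saws.2 ⟨?_, fun i hi => walk_of_le v _ hi, fun i hi => walk_adj hv _ hi, ?_⟩
    · rw [walk, Nat.zero_min, (clock_bounds hv 0).1, (clock_bounds hv 0).2.1]; simp [psum6]
    · have main : ∀ s t, s < t → t ≤ 10 → walk d v (a, b, c, e, f, g) s ≠ walk d v (a, b, c, e, f, g) t := by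
        intro s t hst ht9 hEq
        obtain ⟨hh, hps⟩ := (walk_eq_iff (a, b, c, e, f, g) (by omega) ht9).1 hEq
        have hne : tau v s ≠ tau v t := fun he => ht_ne_of_tau_eq hv hst ht9 he hh
        have hlt : tau v s < tau v t := lt_of_le_of_ne (tau_mono hv hst.le) hne
        have hj6 : tau v t ≤ 6 := (clock_bounds hv t).2.2.2.2.2 ht9
        have hsl := sameLevel_of_witness hst ht9 hh
        generalize hi : tau v s = i at hlt hsl hps
        generalize hj : tau v t = j at hlt hsl hps hj6
        have hcases : (i = 0 ∧ j = 1) ∨ (i = 0 ∧ j = 2) ∨ (i = 1 ∧ j = 2) ∨ (i = 0 ∧ j = 3) ∨ (i = 1 ∧ j = 3) ∨ (i = 2 ∧ j = 3) ∨ (i = 0 ∧ j = 4) ∨ (i = 1 ∧ j = 4) ∨ (i = 2 ∧ j = 4) ∨ (i = 3 ∧ j = 4) ∨ (i = 0 ∧ j = 5) ∨ (i = 1 ∧ j = 5) ∨ (i = 2 ∧ j = 5) ∨ (i = 3 ∧ j = 5) ∨ (i = 4 ∧ j = 5) ∨ (i = 0 ∧ j = 6) ∨ (i = 1 ∧ j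 = 6) ∨ (i = 2 ∧ j = 6) ∨ (i = 3 ∧ j = 6) ∨ (i = 4 ∧ j = 6) ∨ (i = 5 ∧ j = 6) := by
          clear hps hsl hi hj
          interval_cases j <;> interval_cases i <;> decide
        rcases hcases with ⟨rfl, rfl⟩ | ⟨rfl, rfl⟩ | ⟨rfl, rfl⟩ | ⟨rfl, rfl⟩ | ⟨rfl, rfl⟩ | ⟨rfl, rfl⟩ | ⟨rfl, rfl⟩ | ⟨rfl, rfl⟩ | ⟨rfl, rfl⟩ | ⟨rfl, rfl⟩ | ⟨rfl, rfl⟩ | ⟨rfl, rfl⟩ | ⟨rfl, rfl⟩ | ⟨rfl, rfl⟩ | ⟨rfl, rfl⟩ | ⟨rfl, rfl⟩ | ⟨rfl, rfl⟩ | ⟨rfl, rfl⟩ | ⟨rfl, rfl⟩ | ⟨rfl, rfl⟩ | ⟨rfl, rfl⟩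
        · -- (0,1)
          rw [p0, p1] at hps
          have hz : twoStepV d a = 0 := hps.symm
          exact twoStepV_ne_zero d a hz
        · -- (0,2)
          rw [p0, p2] at hps
          have hz : twoStepV d a + twoStepV d b = 0 := hps.symm
          exact g02 hsl ((twoStepV_add_eq_zero_iff d a b).1 hz)
        · -- (1,2)
          rw [p1, p2] at hps
          have hz : twoStepV d b = 0 := by
            have := hps.symm; rw [add_eq_left] at this; exact this
          exact twoStepV_ne_zero d b hz
        · -- (0,3)
          rw [p0, p3] at hps
          have hz : twoStepV d a + twoStepV d b + twoStepV d c = 0 := hps.symm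
          exact twoStepV_add_add_ne_zero d a b c hz
        · -- (1,3)
          rw [p1, p3] at hps
          have hz : twoStepV d b + twoStepV d c = 0 := by
            have := hps.symm; rw [add_assoc, add_eq_left] at this; exact this
          exact g13 hsl ((twoStepV_add_eq_zero_iff d b c).1 hz)
        · -- (2,3)
          rw [p2, p3] at hps
          have hz : twoStepV d c = 0 := by
            have := hps.symm; rw [add_eq_left] at this; exact this
          exact twoStepV_ne_zero d c hz
        · -- (0,4)
          rw [p0, p4] at hps
          have hz : twoStepV d a + twoStepV d b + twoStepV d c + twoStepV d e = 0 := hps.symm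
          exact g04 hsl hz
        · -- (1,4)
          rw [p1, p4] at hps
          have hz : twoStepV d b + twoStepV d c + twoStepV d e = 0 := by
            have := hps.symm; rw [add_assoc, add_assoc, add_eq_left, ← add_assoc] at this; exact this
          exact twoStepV_add_add_ne_zero d b c e hz
        · -- (2,4)
          rw [p2, p4] at hps
          have hz : twoStepV d c + twoStepV d e = 0 := by
            have := hps.symm; rw [add_assoc, add_eq_left] at this; exact this
          exact g24 hsl ((twoStepV_add_eq_zero_iff d c e).1 hz)
        · -- (3,4)
          rw [p3, p4] at hps
          have hz : twoStepV d e = 0 := by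
            have := hps.symm; rw [add_eq_left] at this; exact this
          exact twoStepV_ne_zero d e hz
        · -- (0,5)
          rw [p0, p5] at hps
          have hz : twoStepV d a + twoStepV d b + twoStepV d c + twoStepV d e + twoStepV d f = 0 := hps.symm
          exact twoStepV_sum_five_ne_zero d a b c e f hz
        · -- (1,5)
          rw [p1, p5] at hps
          have hz : twoStepV d b + twoStepV d c + twoStepV d e + twoStepV d f = 0 := by
            have := hps.symm; rw [add_assoc, add_assoc, add_assoc, add_eq_left, ← add_assoc, ← add_assoc] at this; exact this
          exact g15 hsl hz
        · -- (2,5)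
          rw [p2, p5] at hps
          have hz : twoStepV d c + twoStepV d e + twoStepV d f = 0 := by
            have := hps.symm; rw [add_assoc, add_assoc, add_eq_left, ← add_assoc] at this; exact this
          exact twoStepV_add_add_ne_zero d c e f hz
        · -- (3,5)
          rw [p3, p5] at hps
          have hz : twoStepV d e + twoStepV d f = 0 := by
            have := hps.symm; rw [add_assoc, add_eq_left] at this; exact this
          exact g35 hsl ((twoStepV_add_eq_zero_iff d e f).1 hz)
        · -- (4,5)
          rw [p4, p5] at hps
          have hz : twoStepV d f = 0 := by
            have := hps.symm; rw [add_eq_left] at this; exact this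
          exact twoStepV_ne_zero d f hz
        · -- (0,6)
          rw [p0, p6] at hps
          have hz : twoStepV d a + twoStepV d b + twoStepV d c + twoStepV d e + twoStepV d f + twoStepV d g = 0 := hps.symm
          exact g06 hsl hz
        · -- (1,6)
          rw [p1, p6] at hps
          have hz : twoStepV d b + twoStepV d c + twoStepV d e + twoStepV d f + twoStepV d g = 0 := by
            have := hps.symm; rw [add_assoc, add_assoc, add_assoc, add_assoc, add_eq_left, ← add_assoc, ← add_assoc, ← add_assoc] at this; exact this
          exact twoStepV_sum_five_ne_zero d b c e f g hz
        · -- (2,6)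
          rw [p2, p6] at hps
          have hz : twoStepV d c + twoStepV d e + twoStepV d f + twoStepV d g = 0 := by
            have := hps.symm; rw [add_assoc, add_assoc, add_assoc, add_eq_left, ← add_assoc, ← add_assoc] at this; exact this
          exact g26 hsl hz
        · -- (3,6)
          rw [p3, p6] at hps
          have hz : twoStepV d e + twoStepV d f + twoStepV d g = 0 := by
            have := hps.symm; rw [add_assoc, add_assoc, add_eq_left, ← add_assoc] at this; exact this
          exact twoStepV_add_add_ne_zero d e f g hz
        · -- (4,6)
          rw [p4, p6] at hps
          have hz : twoStepV d f + twoStepV d g = 0 := by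
            have := hps.symm; rw [add_assoc, add_eq_left] at this; exact this
          exact g46 hsl ((twoStepV_add_eq_zero_iff d f g).1 hz)
        · -- (5,6)
          rw [p5, p6] at hps
          have hz : twoStepV d g = 0 := by
            have := hps.symm; rw [add_eq_left] at this; exact this
          exact twoStepV_ne_zero d g hz
      intro s hs t ht9 hEq
      simp only [Set.mem_setOf_eq] at hs ht9
      rcases lt_trichotomy s t with hst | rfl | hts
      · exact absurd hEq (main s t hst ht9)
      · rfl
      · exact absurd hEq.symm (main t s hts hs)

/-- The fibre of `v` (shape A): the transverse data of the self-avoiding members. [cite: MadrasSlade1993, §4.2, remark after Theorem 4.2.4 (p. 94)] -/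
def adm (d : ℕ) (v : ℕ × ℕ × ℕ) : Finset (W6 d) := Finset.univ.filter (Good d v)

/-- Membership in the fibre. [cite: MadrasSlade1993, §4.2, remark after Theorem 4.2.4 (p. 94)] -/
theorem mem_adm_iff (hv : IsVert v) {u : W6 d} : u ∈ adm d v ↔ walk d v u ∈ saws (d + 1) 10 := by
  rw [adm, Finset.mem_filter, walk_mem_saws_iff hv]; simp

end selfavoid

/-! ### Shape (B): the word `U U T D T U T D T U` -/

/-- Heights of shape (B): `0, 1, 2, 2, 1, 1, 2, 2, 1, 1, 2`. [cite: MadrasSlade1993, §4.2, remark after Theorem 4.2.4 (p. 94)] -/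
def htB (t : ℕ) : ℕ :=
  if t = 0 then 0 else if t ≤ 1 then 1 else if t ≤ 3 then 2 else if t ≤ 5 then 1 else if t ≤ 7 then 2 else if t ≤ 9 then 1 else 2

/-- Transverse clock of shape (B): the flat steps are at times `2, 4, 6, 8`. [cite: MadrasSlade1993, §4.2, remark after Theorem 4.2.4 (p. 94)] -/
def tauB (t : ℕ) : ℕ := if t ≤ 2 then 0 else if t ≤ 4 then 1 else if t ≤ 6 then 2 else if t ≤ 8 then 3 else 4

/-- Four transverse steps (shape B). [cite: MadrasSlade1993, Definition 1.2.4] -/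
abbrev W4 (d : ℕ) := Idx d × Idx d × Idx d × Idx d

/-- Partial sums of a four-letter word (frozen from `4`). [cite: MadrasSlade1993, Definition 1.2.4] -/
def psumB (d : ℕ) (w : W4 d) : ℕ → Site (d + 1)
  | 0 => 0
  | 1 => twoStepV d w.1
  | 2 => twoStepV d w.1 + twoStepV d w.2.1
  | 3 => twoStepV d w.1 + twoStepV d w.2.1 + twoStepV d w.2.2.1
  | _ + 4 => twoStepV d w.1 + twoStepV d w.2.1 + twoStepV d w.2.2.1 + twoStepV d w.2.2.2

/-- `psumB` has no `e₀`-component. [cite: MadrasSlade1993, Definition 1.2.4] -/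
@[simp] theorem psumB_apply_zero (d : ℕ) (w : W4 d) : ∀ m, psumB d w m 0 = 0
  | 0 => rfl
  | 1 => by simp [psumB]
  | 2 => by simp [psumB]
  | 3 => by simp [psumB]
  | _ + 4 => by simp [psumB]

/-- The `m`-th letter (`m = 0, …, 3`). [cite: MadrasSlade1993, Definition 1.2.4] -/
def nthB (d : ℕ) (w : W4 d) (m : ℕ) : Idx d :=
  if m = 0 then w.1 else if m = 1 then w.2.1 else if m = 2 then w.2.2.1 else w.2.2.2

/-- `psumB (m+1) = psumB m + w_{m+1}` for `m ≤ 3`. [cite: MadrasSlade1993, Definition 1.2.4] -/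
theorem psumB_succ (d : ℕ) (w : W4 d) {m : ℕ} (hm : m ≤ 3) : psumB d w (m + 1) = psumB d w m + twoStepV d (nthB d w m) := by
  interval_cases m <;> simp [psumB, nthB]

/-- ★ The shape-(B) walk with transverse steps `w` (frozen from time `10`). [cite: MadrasSlade1993, §4.2, remark after Theorem 4.2.4 (p. 94)] -/
def walkB (d : ℕ) (w : W4 d) (t : ℕ) : Site (d + 1) := Pi.single 0 (htB (min t 10) : ℤ) + psumB d w (tauB (min t 10))

section shapeB

variable {d : ℕ}

/-- The flat times of shape (B). [cite: MadrasSlade1993, §4.2, remark after Theorem 4.2.4 (p. 94)] -/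
theorem tauB_succ_of_flat {t : ℕ} (h : t = 2 ∨ t = 4 ∨ t = 6 ∨ t = 8) : tauB (t + 1) = tauB t + 1 ∧ htB (t + 1) = htB t ∧ tauB t ≤ 3 := by
  rcases h with rfl | rfl | rfl | rfl <;> decide

/-- The up times of shape (B). [cite: MadrasSlade1993, §4.2, remark after Theorem 4.2.4 (p. 94)] -/
theorem tauB_succ_of_up {t : ℕ} (h : t = 0 ∨ t = 1 ∨ t = 5 ∨ t = 9) : tauB (t + 1) = tauB t ∧ htB (t + 1) = htB t + 1 := by
  rcases h with rfl | rfl | rfl | rfl <;> decide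

/-- The down times of shape (B). [cite: MadrasSlade1993, §4.2, remark after Theorem 4.2.4 (p. 94)] -/
theorem tauB_succ_of_down {t : ℕ} (h : t = 3 ∨ t = 7) : tauB (t + 1) = tauB t ∧ htB (t + 1) + 1 = htB t := by
  rcases h with rfl | rfl <;> decide

/-- Every time `< 10` is flat, up or down. [cite: MadrasSlade1993, §4.2, remark after Theorem 4.2.4 (p. 94)] -/
theorem timeB_cases {t : ℕ} (ht : t < 10) :
    (t = 2 ∨ t = 4 ∨ t = 6 ∨ t = 8) ∨ (t = 0 ∨ t = 1 ∨ t = 5 ∨ t = 9) ∨ (t = 3 ∨ t = 7) := by omega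

/-- Clock and height facts of shape (B). [cite: MadrasSlade1993, §4.2, remark after Theorem 4.2.4 (p. 94)] -/
theorem clockB_bounds (t : ℕ) :
    tauB 0 = 0 ∧ htB 0 = 0 ∧ tauB 10 = 4 ∧ htB 10 = 2 ∧ (1 ≤ t → 1 ≤ htB t ∧ htB t ≤ 2) ∧ (t ≤ 10 → tauB t ≤ 4) := by
  refine ⟨by decide, by decide, by decide, by decide, fun ht1 => ⟨?_, ?_⟩, fun _ => ?_⟩
  · simp only [htB]; split_ifs <;> first | contradiction | omega
  · simp only [htB]; split_ifs <;> first | contradiction | omega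
  · simp only [tauB]; split_ifs <;> first | contradiction | omega

/-- The shape-(B) clock is non-decreasing. [cite: MadrasSlade1993, §4.2, remark after Theorem 4.2.4 (p. 94)] -/
theorem tauB_mono {s t : ℕ} (hst : s ≤ t) : tauB s ≤ tauB t := by
  simp only [tauB]; split_ifs <;> first | contradiction | omega

/-- Two distinct times `s < t ≤ 10` of shape (B) with the same clock value have different heights. [cite: MadrasSlade1993, §4.2, remark after Theorem 4.2.4 (p. 94)] -/
theorem htB_ne_of_tauB_eq {s t : ℕ} (hst : s < t) (ht9 : t ≤ 10) (he : tauB s = tauB t) : htB s ≠ htB t := by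
  have key : ∀ t' < 11, ∀ s' < t', tauB s' = tauB t' → htB s' ≠ htB t' := by decide
  exact key t (by omega) s hst he

/-- Heights along `walkB`. [cite: MadrasSlade1993, §4.2, remark after Theorem 4.2.4 (p. 94)] -/
theorem walkB_apply_zero (w : W4 d) (t : ℕ) : walkB d w t 0 = htB (min t 10) := by
  simp [walkB]

/-- `walkB` is frozen from `10`. [cite: MadrasSlade1993, §4.2, remark after Theorem 4.2.4 (p. 94)] -/
theorem walkB_of_le (w : W4 d) {t : ℕ} (ht9 : 10 ≤ t) : walkB d w t = walkB d w 10 := by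
  simp only [walkB, min_eq_right ht9, min_self]

/-- A flat step of `walkB`. [cite: MadrasSlade1993, Definition 1.2.4] -/
theorem walkB_succ_of_flat (w : W4 d) {t : ℕ} (h : t = 2 ∨ t = 4 ∨ t = 6 ∨ t = 8) :
    walkB d w (t + 1) = walkB d w t + twoStepV d (nthB d w (tauB t)) := by
  have ht9 : t < 10 := by rcases h with rfl | rfl | rfl | rfl <;> norm_num
  obtain ⟨e1, e2, e3⟩ := tauB_succ_of_flat h
  rw [walkB, walkB, min_eq_left ht9.le, min_eq_left (by omega : t + 1 ≤ 10), e1, e2, psumB_succ d w e3]; abel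

/-- An up step of `walkB`. [cite: MadrasSlade1993, Definition 1.2.4] -/
theorem walkB_succ_of_up (w : W4 d) {t : ℕ} (h : t = 0 ∨ t = 1 ∨ t = 5 ∨ t = 9) : walkB d w (t + 1) = walkB d w t + Pi.single 0 1 := by
  have ht9 : t < 10 := by rcases h with rfl | rfl | rfl | rfl <;> norm_num
  obtain ⟨e1, e2⟩ := tauB_succ_of_up h
  rw [walkB, walkB, min_eq_left ht9.le, min_eq_left (by omega : t + 1 ≤ 10), e1, e2, Nat.cast_add, Nat.cast_one, Pi.single_add]; abel

/-- A down step of `walkB`. [cite: MadrasSlade1993, Definition 1.2.4] -/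
theorem walkB_succ_of_down (w : W4 d) {t : ℕ} (h : t = 3 ∨ t = 7) : walkB d w (t + 1) = walkB d w t - Pi.single 0 1 := by
  have ht9 : t < 10 := by rcases h with rfl | rfl <;> norm_num
  obtain ⟨e1, e2⟩ := tauB_succ_of_down h
  rw [walkB, walkB, min_eq_left ht9.le, min_eq_left (by omega : t + 1 ≤ 10), e1, ← e2, Nat.cast_add, Nat.cast_one, Pi.single_add]
  abel

/-- Consecutive sites of `walkB` are lattice neighbours. [cite: MadrasSlade1993, Definition 1.2.4] -/
theorem walkB_adj (w : W4 d) {t : ℕ} (ht9 : t < 10) : (zdGraph (d + 1)).Adj (walkB d w t) (walkB d w (t + 1)) := by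
  rcases timeB_cases ht9 with h | h | h
  · rw [walkB_succ_of_flat w h]; exact adj_add_twoStepV d _ _
  · rw [walkB_succ_of_up w h]; exact adj_add_e0' d _
  · have e := walkB_succ_of_down w h
    rw [show walkB d w t = walkB d w (t + 1) + Pi.single 0 1 by rw [e]; abel]
    exact (adj_add_e0' d _).symm

/-- `walkB` is a bridge of span two. [cite: MadrasSlade1993, §4.2, remark after Theorem 4.2.4 (p. 94)] -/
theorem walkB_isBridge (w : W4 d) : IsBridge 10 (walkB d w) := by
  intro i hi1 hi9
  rw [walkB_apply_zero, walkB_apply_zero, walkB_apply_zero, min_eq_left hi9, Nat.zero_min, min_self]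
  obtain ⟨-, h0, -, h9, hr, -⟩ := clockB_bounds i
  obtain ⟨h1', h2'⟩ := hr hi1
  rw [h0, h9]
  exact ⟨by exact_mod_cast h1', by exact_mod_cast h2'⟩

/-- `walkB` has no renewal time in `[1, 9]`. [cite: DuminilCopinHammond2013, §2.2] -/
theorem walkB_not_renewal (w : W4 d) {k : ℕ} (hk1 : 1 ≤ k) (hk8 : k ≤ 10 - 1) : ¬ IsRenewalTime 10 (walkB d w) k := by
  rintro ⟨-, hb1, hb2⟩
  have hle : ∀ i, 1 ≤ i → i ≤ k → htB i ≤ htB k := by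
    intro i hi1 hi2
    have := (hb1 i hi1 hi2).2
    rw [walkB_apply_zero, walkB_apply_zero, min_eq_left (by omega : i ≤ 10), min_eq_left (by omega : k ≤ 10)] at this
    exact_mod_cast this
  have hgt : ∀ j, 1 ≤ j → j ≤ 10 - k → htB k < htB (k + j) := by
    intro j hj1 hj2
    have := (hb2 j hj1 hj2).1
    simp only [add_zero] at this
    rw [walkB_apply_zero, walkB_apply_zero, min_eq_left (by omega : k ≤ 10), min_eq_left (by omega : k + j ≤ 10)] at this
    exact_mod_cast this
  have e9 := hgt (10 - k) (by omega) le_rfl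
  rw [show k + (10 - k) = 10 by omega, show htB 10 = 2 by decide] at e9
  by_cases hk : k = 1
  · subst hk
    have := hgt 3 (by norm_num) (by norm_num)
    revert this; decide
  · have := hle 2 (by norm_num) (by omega)
    rw [show htB 2 = 2 by decide] at this
    omega

/-- Self-avoiding `walkB` are irreducible bridges of cost eight. [cite: DuminilCopinHammond2013, §2.2] -/
theorem walkB_mem_filter {w : W4 d} (hu : walkB d w ∈ saws (d + 1) 10) :
    walkB d w ∈ (irreducibleBridges (d + 1) 10).filter fun ω => costZd d 10 ω = 8 := by
  refine Finset.mem_filter.2 ⟨mem_irreducibleBridges.2 ⟨mem_bridges.2 ⟨hu, walkB_isBridge w⟩,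
    ⟨by omega, walkB_isBridge w, fun k hk1 hk2 => walkB_not_renewal w hk1 hk2⟩⟩, ?_⟩
  rw [costZd, walkB_apply_zero, min_self, show htB 10 = 2 by decide]
  rfl

/-- `walkB` is injective. [cite: MadrasSlade1993, Definition 1.2.4] -/
theorem walkB_injective : Function.Injective (walkB d) := by
  intro w w' h
  have key : ∀ t, (t = 2 ∨ t = 4 ∨ t = 6 ∨ t = 8) → twoStepV d (nthB d w (tauB t)) = twoStepV d (nthB d w' (tauB t)) := by
    intro t ht
    have e1 := walkB_succ_of_flat w ht
    have e2 := walkB_succ_of_flat w' ht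
    rw [h] at e1
    exact add_left_cancel (e1.symm.trans e2)
  have k0 := key 2 (by norm_num); have k1 := key 4 (by norm_num); have k2 := key 6 (by norm_num); have k3 := key 8 (by norm_num)
  obtain ⟨w1, w2, w3, w4⟩ := w; obtain ⟨x1, x2, x3, x4⟩ := w'
  simp only [nthB, tauB] at k0 k1 k2 k3
  norm_num at k0 k1 k2 k3
  rw [twoStepV_injective d k0, twoStepV_injective d k1, twoStepV_injective d k2, twoStepV_injective d k3]

/-- The block condition of shape (B): a four-step self-avoiding word. [cite: MadrasSlade1993, §4.2, remark after Theorem 4.2.4 (p. 94)] -/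
def GoodB (d : ℕ) (w : W4 d) : Prop :=
  w.2.1 ≠ revIdx w.1 ∧ w.2.2.1 ≠ revIdx w.2.1 ∧ w.2.2.2 ≠ revIdx w.2.2.1 ∧
    twoStepV d w.1 + twoStepV d w.2.1 + twoStepV d w.2.2.1 + twoStepV d w.2.2.2 ≠ 0

/-- `GoodB` is decidable. [cite: MadrasSlade1993, §4.2, remark after Theorem 4.2.4 (p. 94)] -/
instance (d : ℕ) : DecidablePred (GoodB d) := fun w => by unfold GoodB; infer_instance

/-- Two sites of `walkB` coincide iff their heights and partial sums do. [cite: MadrasSlade1993, Definition 1.2.4] -/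
theorem walkB_eq_iff (w : W4 d) {s t : ℕ} (hs : s ≤ 10) (ht9 : t ≤ 10) :
    walkB d w s = walkB d w t ↔ htB s = htB t ∧ psumB d w (tauB s) = psumB d w (tauB t) := by
  constructor
  · intro h
    have h0 := congrFun h 0
    rw [walkB_apply_zero, walkB_apply_zero, min_eq_left hs, min_eq_left ht9] at h0
    have h0' : htB s = htB t := by exact_mod_cast h0
    refine ⟨h0', ?_⟩
    rw [walkB, walkB, min_eq_left hs, min_eq_left ht9, h0'] at h
    exact add_left_cancel h
  · rintro ⟨h1, h2⟩
    rw [walkB, walkB, min_eq_left hs, min_eq_left ht9, h1, h2]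

/-- ★ **Self-avoidance of `walkB w` is `GoodB w`** (every even-gap pair of clock values meets at both levels). [cite: MadrasSlade1993, §4.2, remark after Theorem 4.2.4 (p. 94)] -/
theorem walkB_mem_saws_iff (w : W4 d) : walkB d w ∈ saws (d + 1) 10 ↔ GoodB d w := by
  obtain ⟨a, b, c, e⟩ := w
  have p0 : psumB d (a, b, c, e) 0 = 0 := rfl
  have p1 : psumB d (a, b, c, e) 1 = twoStepV d a := rfl
  have p2 : psumB d (a, b, c, e) 2 = twoStepV d a + twoStepV d b := rfl
  have p3 : psumB d (a, b, c, e) 3 = twoStepV d a + twoStepV d b + twoStepV d c := rfl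
  have p4 : psumB d (a, b, c, e) 4 = twoStepV d a + twoStepV d b + twoStepV d c + twoStepV d e := rfl
  constructor
  · intro hω
    obtain ⟨-, -, -, hinj⟩ := mem_saws.1 hω
    have key : ∀ s t, s < t → t ≤ 10 → htB s = htB t → psumB d (a, b, c, e) (tauB s) ≠ psumB d (a, b, c, e) (tauB t) := by
      intro s t hst ht9 hh hEq
      have := hinj (show s ∈ {k : ℕ | k ≤ 10} from by simp; omega) (show t ∈ {k : ℕ | k ≤ 10} from ht9)
        ((walkB_eq_iff (a, b, c, e) (by omega) ht9).2 ⟨hh, hEq⟩)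
      omega
    have k15 := key 1 5 (by norm_num) (by norm_num) (by decide)
    have k48 := key 4 8 (by norm_num) (by norm_num) (by decide)
    have k59 := key 5 9 (by norm_num) (by norm_num) (by decide)
    have k19 := key 1 9 (by norm_num) (by norm_num) (by decide)
    simp only [tauB] at k15 k48 k59 k19
    norm_num at k15 k48 k59 k19
    rw [p0, p2] at k15
    rw [p1, p3] at k48
    rw [p2, p4] at k59
    rw [p0, p4] at k19
    simp only [GoodB]
    refine ⟨fun hba => k15 ?_, fun hcb => k48 ?_, fun hec => k59 ?_, fun h4 => k19 ?_⟩
    · rw [hba, twoStepV_revIdx]; abel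
    · rw [hcb, twoStepV_revIdx]; abel
    · rw [hec, twoStepV_revIdx]; abel
    · rw [h4]
  · rintro ⟨g02, g13, g24, g04⟩
    refine mem_saws.2 ⟨?_, fun i hi => walkB_of_le _ hi, fun i hi => walkB_adj _ hi, ?_⟩
    · rw [walkB, Nat.zero_min, (clockB_bounds 0).1, (clockB_bounds 0).2.1]; simp [psumB]
    · have main : ∀ s t, s < t → t ≤ 10 → walkB d (a, b, c, e) s ≠ walkB d (a, b, c, e) t := by
        intro s t hst ht9 hEq
        obtain ⟨hh, hps⟩ := (walkB_eq_iff (a, b, c, e) (by omega) ht9).1 hEq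
        have hne : tauB s ≠ tauB t := fun he => htB_ne_of_tauB_eq hst ht9 he hh
        have hlt : tauB s < tauB t := lt_of_le_of_ne (tauB_mono hst.le) hne
        have hj4 : tauB t ≤ 4 := (clockB_bounds t).2.2.2.2.2 ht9
        generalize hi : tauB s = i at hlt hps
        generalize hj : tauB t = j at hlt hps hj4
        have hcases : (i = 0 ∧ j = 1) ∨ (i = 0 ∧ j = 2) ∨ (i = 1 ∧ j = 2) ∨ (i = 0 ∧ j = 3) ∨ (i = 1 ∧ j = 3) ∨ (i = 2 ∧ j = 3) ∨ (i = 0 ∧ j = 4) ∨ (i = 1 ∧ j = 4) ∨ (i = 2 ∧ j = 4) ∨ (i = 3 ∧ j = 4) := by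
          clear hps hi hj
          interval_cases j <;> interval_cases i <;> decide
        rcases hcases with ⟨rfl, rfl⟩ | ⟨rfl, rfl⟩ | ⟨rfl, rfl⟩ | ⟨rfl, rfl⟩ | ⟨rfl, rfl⟩ | ⟨rfl, rfl⟩ | ⟨rfl, rfl⟩ | ⟨rfl, rfl⟩ | ⟨rfl, rfl⟩ | ⟨rfl, rfl⟩
        · -- (0,1)
          rw [p0, p1] at hps
          have hz : twoStepV d a = 0 := hps.symm
          exact twoStepV_ne_zero d a hz
        · -- (0,2)
          rw [p0, p2] at hps
          have hz : twoStepV d a + twoStepV d b = 0 := hps.symm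
          exact g02 ((twoStepV_add_eq_zero_iff d a b).1 hz)
        · -- (1,2)
          rw [p1, p2] at hps
          have hz : twoStepV d b = 0 := by
            have := hps.symm; rw [add_eq_left] at this; exact this
          exact twoStepV_ne_zero d b hz
        · -- (0,3)
          rw [p0, p3] at hps
          have hz : twoStepV d a + twoStepV d b + twoStepV d c = 0 := hps.symm
          exact twoStepV_add_add_ne_zero d a b c hz
        · -- (1,3)
          rw [p1, p3] at hps
          have hz : twoStepV d b + twoStepV d c = 0 := by
            have := hps.symm; rw [add_assoc, add_eq_left] at this; exact this
          exact g13 ((twoStepV_add_eq_zero_iff d b c).1 hz)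
        · -- (2,3)
          rw [p2, p3] at hps
          have hz : twoStepV d c = 0 := by
            have := hps.symm; rw [add_eq_left] at this; exact this
          exact twoStepV_ne_zero d c hz
        · -- (0,4)
          rw [p0, p4] at hps
          have hz : twoStepV d a + twoStepV d b + twoStepV d c + twoStepV d e = 0 := hps.symm
          exact g04 hz
        · -- (1,4)
          rw [p1, p4] at hps
          have hz : twoStepV d b + twoStepV d c + twoStepV d e = 0 := by
            have := hps.symm; rw [add_assoc, add_assoc, add_eq_left, ← add_assoc] at this; exact this
          exact twoStepV_add_add_ne_zero d b c e hz
        · -- (2,4)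
          rw [p2, p4] at hps
          have hz : twoStepV d c + twoStepV d e = 0 := by
            have := hps.symm; rw [add_assoc, add_eq_left] at this; exact this
          exact g24 ((twoStepV_add_eq_zero_iff d c e).1 hz)
        · -- (3,4)
          rw [p3, p4] at hps
          have hz : twoStepV d e = 0 := by
            have := hps.symm; rw [add_eq_left] at this; exact this
          exact twoStepV_ne_zero d e hz
      intro s hs t ht9 hEq
      simp only [Set.mem_setOf_eq] at hs ht9
      rcases lt_trichotomy s t with hst | rfl | hts
      · exact absurd hEq (main s t hst ht9)
      · rfl
      · exact absurd hEq.symm (main t s hts hs)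

/-- The shape-(B) fibre. [cite: MadrasSlade1993, §4.2, remark after Theorem 4.2.4 (p. 94)] -/
def admB (d : ℕ) : Finset (W4 d) := Finset.univ.filter (GoodB d)

/-- Membership in the shape-(B) fibre. [cite: MadrasSlade1993, §4.2, remark after Theorem 4.2.4 (p. 94)] -/
theorem mem_admB_iff {w : W4 d} : w ∈ admB d ↔ walkB d w ∈ saws (d + 1) 10 := by
  rw [admB, Finset.mem_filter, walkB_mem_saws_iff]; simp

/-- ★ The shape-(B) fibre is the index set of the four-step self-avoiding walks. [cite: MadrasSlade1993, §4.2, remark after Theorem 4.2.4 (p. 94)] -/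
theorem admB_eq : admB d = fiveStepIndex d := by
  ext ⟨a, b, c, e⟩
  simp only [admB, GoodB, fiveStepIndex, Finset.mem_filter, Finset.mem_univ, true_and]
  constructor
  · rintro ⟨h1, h2, h3, h4⟩
    refine ⟨h1, h2, h3, ?_⟩
    rintro ⟨hca, heb⟩; apply h4; rw [hca, heb, twoStepV_revIdx, twoStepV_revIdx]; abel
  · rintro ⟨h1, h2, h3, h4⟩
    refine ⟨h1, h2, h3, fun hs => ?_⟩
    rcases (ThreeSlackTwo.sum_four_eq_zero_iff d a b c e).1 hs with ⟨hba, -⟩ | ⟨hca, heb⟩ | ⟨-, hcb⟩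
    · exact h1 hba
    · exact h4 ⟨hca, heb⟩
    · exact h2 hcb

/-- `#admB = c₄(ℤ^d) = 2d(2d−1)³ − 2d(2d−2)`. [cite: MadrasSlade1993, §4.2, eq. (4.2.20)–(4.2.22) (p. 94, 2013 reprint)] -/
theorem card_admB : (admB d).card = 2 * d * (2 * d - 1) ^ 3 - 2 * d * (2 * d - 2) := by
  rw [admB_eq, card_fiveStepIndex]

end shapeB

/-! ### The converse: every cost-eight irreducible bridge of length ten is a table-driven walk of shape (A) or (B) -/

section converse

variable {d : ℕ} {v : ℕ × ℕ × ℕ}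

/-- Two flat times of shape (A) with the same clock value coincide. [cite: MadrasSlade1993, §4.2, remark after Theorem 4.2.4 (p. 94)] -/
theorem flat_unique (hv : IsVert v) {t t' : ℕ} (ht9 : t < 10) (ht9' : t' < 10) (hft : ¬ IsVTime v t) (hft' : ¬ IsVTime v t')
    (he : tau v t = tau v t') : t = t' := by
  by_contra hne
  rcases Nat.lt_or_gt_of_ne hne with hlt | hlt
  · have h1 := (tau_succ_of_flat hv ht9 hft).1
    have h2 := tau_mono hv (show t + 1 ≤ t' by omega)
    omega
  · have h1 := (tau_succ_of_flat hv ht9' hft').1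
    have h2 := tau_mono hv (show t' + 1 ≤ t by omega)
    omega

/-- A self-avoiding walk whose heights follow the table `ht v` is `walk v u` for the transverse steps `u` it takes at the six flat times.
[cite: MadrasSlade1993, §4.2, remark after Theorem 4.2.4 (p. 94)] -/
theorem exists_eq_walk_of_heights (hv : IsVert v) {ω : ℕ → Site (d + 1)} (hω : ω ∈ saws (d + 1) 10)
    (hH : ∀ t, t ≤ 10 → ω t 0 = ht v t) : ∃ u : W6 d, ω = walk d v u := by
  obtain ⟨h0, hend, hadj, -⟩ := mem_saws.1 hω
  have hflatH : ∀ t, t < 10 → ¬ IsVTime v t → ω (t + 1) 0 = ω t 0 := by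
    intro t ht9 hft
    rw [hH (t + 1) (by omega), hH t ht9.le, (tau_succ_of_flat hv ht9 hft).2.1]
  obtain ⟨t0, h90, hf0, hc0⟩ := exists_flat_of_lt_six hv (m := 0) (by norm_num)
  obtain ⟨t1, h91, hf1, hc1⟩ := exists_flat_of_lt_six hv (m := 1) (by norm_num)
  obtain ⟨t2, h92, hf2, hc2⟩ := exists_flat_of_lt_six hv (m := 2) (by norm_num)
  obtain ⟨t3, h93, hf3, hc3⟩ := exists_flat_of_lt_six hv (m := 3) (by norm_num)
  obtain ⟨t4, h94, hf4, hc4⟩ := exists_flat_of_lt_six hv (m := 4) (by norm_num)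
  obtain ⟨t5, h95, hf5, hc5⟩ := exists_flat_of_lt_six hv (m := 5) (by norm_num)
  obtain ⟨w0, hw0⟩ := exists_twoStepV_of_adj d (hadj t0 h90) (hflatH t0 h90 hf0)
  obtain ⟨w1, hw1⟩ := exists_twoStepV_of_adj d (hadj t1 h91) (hflatH t1 h91 hf1)
  obtain ⟨w2, hw2⟩ := exists_twoStepV_of_adj d (hadj t2 h92) (hflatH t2 h92 hf2)
  obtain ⟨w3, hw3⟩ := exists_twoStepV_of_adj d (hadj t3 h93) (hflatH t3 h93 hf3)
  obtain ⟨w4, hw4⟩ := exists_twoStepV_of_adj d (hadj t4 h94) (hflatH t4 h94 hf4)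
  obtain ⟨w5, hw5⟩ := exists_twoStepV_of_adj d (hadj t5 h95) (hflatH t5 h95 hf5)
  set u : W6 d := (w0, w1, w2, w3, w4, w5) with hu
  have main : ∀ t, t ≤ 10 → ω t = walk d v u t := by
    intro t
    induction t with
    | zero =>
      intro _
      rw [h0, walk, Nat.zero_min, (clock_bounds hv 0).1, (clock_bounds hv 0).2.1]; simp [psum6]
    | succ t ih =>
      intro ht9
      have prev := ih (by omega)
      by_cases hft : IsVTime v t
      · rcases hft with hx | hx | hx | hx
        · have hup : ω (t + 1) 0 = ω t 0 + 1 := by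
            rw [hH (t + 1) ht9, hH t (by omega), (tau_succ_of_up hv (Or.inl hx)).2]; push_cast; ring
          rw [eq_add_e0_of_adj d (hadj t (by omega)) hup, prev, walk_succ_of_up hv u (Or.inl hx)]
        · have hup : ω (t + 1) 0 = ω t 0 + 1 := by
            rw [hH (t + 1) ht9, hH t (by omega), (tau_succ_of_up hv (Or.inr (Or.inl hx))).2]; push_cast; ring
          rw [eq_add_e0_of_adj d (hadj t (by omega)) hup, prev, walk_succ_of_up hv u (Or.inr (Or.inl hx))]
        · have hdn : ω (t + 1) 0 = ω t 0 - 1 := by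
            rw [hH (t + 1) ht9, hH t (by omega), ← (tau_succ_of_down hv hx).2]; push_cast; ring
          rw [eq_sub_e0_of_adj d (hadj t (by omega)) hdn, prev, walk_succ_of_down hv u hx]
        · have hup : ω (t + 1) 0 = ω t 0 + 1 := by
            rw [hH (t + 1) ht9, hH t (by omega), (tau_succ_of_up hv (Or.inr (Or.inr hx))).2]; push_cast; ring
          rw [eq_add_e0_of_adj d (hadj t (by omega)) hup, prev, walk_succ_of_up hv u (Or.inr (Or.inr hx))]
      · have ht9' : t < 10 := by omega
        rw [walk_succ_of_flat hv u ht9' hft, ← prev]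
        have hm5 := (tau_succ_of_flat hv ht9' hft).2.2
        have hcases : tau v t = 0 ∨ tau v t = 1 ∨ tau v t = 2 ∨ tau v t = 3 ∨ tau v t = 4 ∨ tau v t = 5 := by omega
        rcases hcases with hm | hm | hm | hm | hm | hm
        · obtain rfl := flat_unique hv ht9' h90 hft hf0 (hm.trans hc0.symm)
          rw [hw0, hm]; simp [nth6, hu]
        · obtain rfl := flat_unique hv ht9' h91 hft hf1 (hm.trans hc1.symm)
          rw [hw1, hm]; simp [nth6, hu]
        · obtain rfl := flat_unique hv ht9' h92 hft hf2 (hm.trans hc2.symm)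
          rw [hw2, hm]; simp [nth6, hu]
        · obtain rfl := flat_unique hv ht9' h93 hft hf3 (hm.trans hc3.symm)
          rw [hw3, hm]; simp [nth6, hu]
        · obtain rfl := flat_unique hv ht9' h94 hft hf4 (hm.trans hc4.symm)
          rw [hw4, hm]; simp [nth6, hu]
        · obtain rfl := flat_unique hv ht9' h95 hft hf5 (hm.trans hc5.symm)
          rw [hw5, hm]; simp [nth6, hu]
  refine ⟨u, funext fun t => ?_⟩
  rcases Nat.lt_or_ge t 11 with ht | ht
  · exact main t (by omega)
  · rw [hend t (by omega), walk_of_le v u (show 10 ≤ t by omega), main 10 le_rfl]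

/-- A self-avoiding walk whose heights follow the shape-(B) table is `walkB w` for the transverse steps it takes at times `2, 4, 6, 8`.
[cite: MadrasSlade1993, §4.2, remark after Theorem 4.2.4 (p. 94)] -/
theorem exists_eq_walkB_of_heights {ω : ℕ → Site (d + 1)} (hω : ω ∈ saws (d + 1) 10) (hH : ∀ t, t ≤ 10 → ω t 0 = htB t) :
    ∃ w : W4 d, ω = walkB d w := by
  obtain ⟨h0, hend, hadj, -⟩ := mem_saws.1 hω
  have hflatH : ∀ t, (t = 2 ∨ t = 4 ∨ t = 6 ∨ t = 8) → ω (t + 1) 0 = ω t 0 := by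
    intro t ht
    have ht9 : t < 10 := by rcases ht with rfl | rfl | rfl | rfl <;> norm_num
    rw [hH (t + 1) (by omega), hH t ht9.le, (tauB_succ_of_flat ht).2.1]
  obtain ⟨w0, hw0⟩ := exists_twoStepV_of_adj d (hadj 2 (by norm_num)) (hflatH 2 (by norm_num))
  obtain ⟨w1, hw1⟩ := exists_twoStepV_of_adj d (hadj 4 (by norm_num)) (hflatH 4 (by norm_num))
  obtain ⟨w2, hw2⟩ := exists_twoStepV_of_adj d (hadj 6 (by norm_num)) (hflatH 6 (by norm_num))
  obtain ⟨w3, hw3⟩ := exists_twoStepV_of_adj d (hadj 8 (by norm_num)) (hflatH 8 (by norm_num))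
  set w : W4 d := (w0, w1, w2, w3) with hw
  have main : ∀ t, t ≤ 10 → ω t = walkB d w t := by
    intro t
    induction t with
    | zero =>
      intro _
      rw [h0, walkB, Nat.zero_min, (clockB_bounds 0).1, (clockB_bounds 0).2.1]; simp [psumB]
    | succ t ih =>
      intro ht9
      have prev := ih (by omega)
      rcases timeB_cases (show t < 10 by omega) with hx | hx | hx
      · rw [walkB_succ_of_flat w hx, ← prev]
        rcases hx with rfl | rfl | rfl | rfl
        · rw [hw0]; simp [nthB, tauB, hw]
        · rw [hw1]; simp [nthB, tauB, hw]
        · rw [hw2]; simp [nthB, tauB, hw]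
        · rw [hw3]; simp [nthB, tauB, hw]
      · have hup : ω (t + 1) 0 = ω t 0 + 1 := by
          rw [hH (t + 1) ht9, hH t (by omega), (tauB_succ_of_up hx).2]; push_cast; ring
        rw [eq_add_e0_of_adj d (hadj t (by omega)) hup, prev, walkB_succ_of_up w hx]
      · have hdn : ω (t + 1) 0 = ω t 0 - 1 := by
          rw [hH (t + 1) ht9, hH t (by omega), ← (tauB_succ_of_down hx).2]; push_cast; ring
        rw [eq_sub_e0_of_adj d (hadj t (by omega)) hdn, prev, walkB_succ_of_down w hx]
  refine ⟨w, funext fun t => ?_⟩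
  rcases Nat.lt_or_ge t 11 with ht | ht
  · exact main t (by omega)
  · rw [hend t (by omega), walkB_of_le w (show 10 ≤ t by omega), main 10 le_rfl]

/-- Eleven listed heights give the shape-(A) height table. [cite: MadrasSlade1993, §4.2, remark after Theorem 4.2.4 (p. 94)] -/
theorem heights_intro (v : ℕ × ℕ × ℕ) {ω : ℕ → Site (d + 1)}
    (h : ω 0 0 = ht v 0 ∧ ω 1 0 = ht v 1 ∧ ω 2 0 = ht v 2 ∧ ω 3 0 = ht v 3 ∧ ω 4 0 = ht v 4 ∧ ω 5 0 = ht v 5 ∧ ω 6 0 = ht v 6 ∧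
      ω 7 0 = ht v 7 ∧ ω 8 0 = ht v 8 ∧ ω 9 0 = ht v 9 ∧ ω 10 0 = ht v 10) : ∀ t, t ≤ 10 → ω t 0 = ht v t := by
  obtain ⟨h0, h1, h2, h3, h4, h5, h6, h7, h8, h9, h10⟩ := h
  intro t ht9
  interval_cases t <;> assumption

/-- Eleven listed heights give the shape-(B) height table. [cite: MadrasSlade1993, §4.2, remark after Theorem 4.2.4 (p. 94)] -/
theorem heightsB_intro {ω : ℕ → Site (d + 1)}
    (h : ω 0 0 = htB 0 ∧ ω 1 0 = htB 1 ∧ ω 2 0 = htB 2 ∧ ω 3 0 = htB 3 ∧ ω 4 0 = htB 4 ∧ ω 5 0 = htB 5 ∧ ω 6 0 = htB 6 ∧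
      ω 7 0 = htB 7 ∧ ω 8 0 = htB 8 ∧ ω 9 0 = htB 9 ∧ ω 10 0 = htB 10) : ∀ t, t ≤ 10 → ω t 0 = htB t := by
  obtain ⟨h0, h1, h2, h3, h4, h5, h6, h7, h8, h9, h10⟩ := h
  intro t ht9
  interval_cases t <;> assumption

/-- ★ The height profile of a cost-eight irreducible bridge of length ten: one of the thirty-five shape-(A) tables or the shape-(B) table
(the 256 height sequences split explicitly; 220 die on the tree lemmas). [cite: DuminilCopinHammond2013, §2.2] -/
theorem exists_shape_of_mem {ω : ℕ → Site (d + 1)}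
    (hω : ω ∈ (irreducibleBridges (d + 1) 10).filter fun ω => costZd d 10 ω = 8) :
    (∃ v : ℕ × ℕ × ℕ, IsVert v ∧ ∀ t, t ≤ 10 → ω t 0 = ht v t) ∨ (∀ t, t ≤ 10 → ω t 0 = htB t) := by
  obtain ⟨hirr, hcost⟩ := Finset.mem_filter.1 hω
  obtain ⟨hbr, -⟩ := mem_irreducibleBridges.1 hirr
  obtain ⟨hωs, hb⟩ := mem_bridges.1 hbr
  obtain ⟨h0, -, hadj, -⟩ := mem_saws.1 hωs
  have hx0 : ω 0 0 = 0 := by rw [h0]; rfl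
  have hx1 : ω 1 0 = 1 := by rw [apply_one_eq_e0_of_mem_bridges d (by norm_num) hbr]; simp
  have hx10 : ω 10 0 = 2 := by
    have hc : costZd d 10 ω = 8 := hcost
    simp only [costZd] at hc
    have := (span_le_and_cost_bound_zd hirr).1
    have h90 : 0 < ω 10 0 := by have := (hb 10 (by norm_num) le_rfl).1; rwa [h0] at this
    omega
  have hrange : ∀ i, 1 ≤ i → i ≤ 10 → ω i 0 = 1 ∨ ω i 0 = 2 := by
    intro i hi1 hi9
    have h := hb i hi1 hi9
    rw [h0, hx10] at h
    simp only [Pi.zero_apply] at h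
    omega
  have n121 : ∀ i, i + 2 ≤ 10 → ¬ (ω i 0 = 1 ∧ ω (i + 1) 0 = 2 ∧ ω (i + 2) 0 = 1) := by
    rintro i hi ⟨e1, e2, e3⟩
    exact no_up_down_of_mem_saws d hωs hi (by rw [e1, e2]; norm_num) (by rw [e2, e3]; norm_num)
  have n212 : ∀ i, i + 2 ≤ 10 → ¬ (ω i 0 = 2 ∧ ω (i + 1) 0 = 1 ∧ ω (i + 2) 0 = 2) := by
    rintro i hi ⟨e1, e2, e3⟩
    exact no_down_up_of_mem_saws d hωs hi (by rw [e1, e2]; norm_num) (by rw [e2, e3]; norm_num)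
  have nmono : ¬ (ω 1 0 ≤ ω 2 0 ∧ ω 2 0 ≤ ω 3 0 ∧ ω 3 0 ≤ ω 4 0 ∧ ω 4 0 ≤ ω 5 0 ∧ ω 5 0 ≤ ω 6 0 ∧ ω 6 0 ≤ ω 7 0 ∧
      ω 7 0 ≤ ω 8 0 ∧ ω 8 0 ≤ ω 9 0 ∧ ω 9 0 ≤ ω 10 0) := by
    rintro ⟨m1, m2, m3, m4, m5, m6, m7, m8, m9⟩
    refine not_irreducible_of_monotone d hirr (fun i hi => ?_) (by rw [hx10])
    interval_cases i
    · rw [hx0, hx1]; norm_num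
    · exact m1
    · exact m2
    · exact m3
    · exact m4
    · exact m5
    · exact m6
    · exact m7
    · exact m8
    · exact m9
  have a1 := n121 1 (by norm_num); have a2 := n121 2 (by norm_num); have a3 := n121 3 (by norm_num); have a4 := n121 4 (by norm_num)
  have a5 := n121 5 (by norm_num); have a6 := n121 6 (by norm_num); have a7 := n121 7 (by norm_num); have a8 := n121 8 (by norm_num)
  have b2 := n212 2 (by norm_num); have b3 := n212 3 (by norm_num); have b4 := n212 4 (by norm_num); have b5 := n212 5 (by norm_num)
  have b6 := n212 6 (by norm_num); have b7 := n212 7 (by norm_num); have b8 := n212 8 (by norm_num)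
  norm_num at a1 a2 a3 a4 a5 a6 a7 a8 b2 b3 b4 b5 b6 b7 b8
  obtain h2 := hrange 2 (by norm_num) (by norm_num); obtain h3 := hrange 3 (by norm_num) (by norm_num)
  obtain h4 := hrange 4 (by norm_num) (by norm_num); obtain h5 := hrange 5 (by norm_num) (by norm_num)
  obtain h6 := hrange 6 (by norm_num) (by norm_num); obtain h7 := hrange 7 (by norm_num) (by norm_num)
  obtain h8 := hrange 8 (by norm_num) (by norm_num); obtain h9 := hrange 9 (by norm_num) (by norm_num)
  rcases h2 with e2 | e2 <;> rcases h3 with e3 | e3 <;> rcases h4 with e4 | e4 <;> rcases h5 with e5 | e5 <;> rcases h6 with e6 | e6 <;>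
    rcases h7 with e7 | e7 <;> rcases h8 with e8 | e8 <;> rcases h9 with e9 | e9
  · exact (nmono ⟨by norm_num [hx1, e2], by norm_num [e2, e3], by norm_num [e3, e4], by norm_num [e4, e5], by norm_num [e5, e6], by norm_num [e6, e7], by norm_num [e7, e8], by norm_num [e8, e9], by norm_num [e9, hx10]⟩).elim
  · exact (nmono ⟨by norm_num [hx1, e2], by norm_num [e2, e3], by norm_num [e3, e4], by norm_num [e4, e5], by norm_num [e5, e6], by norm_num [e6, e7], by norm_num [e7, e8], by norm_num [e8, e9], by norm_num [e9, hx10]⟩).elim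
  · exact (a7 e7 e8 e9).elim
  · exact (nmono ⟨by norm_num [hx1, e2], by norm_num [e2, e3], by norm_num [e3, e4], by norm_num [e4, e5], by norm_num [e5, e6], by norm_num [e6, e7], by norm_num [e7, e8], by norm_num [e8, e9], by norm_num [e9, hx10]⟩).elim
  · exact (a6 e6 e7 e8).elim
  · exact (a6 e6 e7 e8).elim
  · exact (b8 e8 e9 hx10).elim
  · exact (nmono ⟨by norm_num [hx1, e2], by norm_num [e2, e3], by norm_num [e3, e4], by norm_num [e4, e5], by norm_num [e5, e6], by norm_num [e6, e7], by norm_num [e7, e8], by norm_num [e8, e9], by norm_num [e9, hx10]⟩).elim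
  · exact (a5 e5 e6 e7).elim
  · exact (a5 e5 e6 e7).elim
  · exact (a5 e5 e6 e7).elim
  · exact (a5 e5 e6 e7).elim
  · exact Or.inl ⟨(5, 7, 9), by decide, heights_intro (5, 7, 9) ⟨by rw [hx0]; rfl, by rw [hx1]; rfl, by rw [e2]; rfl, by rw [e3]; rfl, by rw [e4]; rfl, by rw [e5]; rfl, by rw [e6]; rfl, by rw [e7]; rfl, by rw [e8]; rfl, by rw [e9]; rfl, by rw [hx10]; rfl⟩⟩
  · exact (b7 e7 e8 e9).elim
  · exact (b8 e8 e9 hx10).elim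
  · exact (nmono ⟨by norm_num [hx1, e2], by norm_num [e2, e3], by norm_num [e3, e4], by norm_num [e4, e5], by norm_num [e5, e6], by norm_num [e6, e7], by norm_num [e7, e8], by norm_num [e8, e9], by norm_num [e9, hx10]⟩).elim
  · exact (a4 e4 e5 e6).elim
  · exact (a4 e4 e5 e6).elim
  · exact (a4 e4 e5 e6).elim
  · exact (a4 e4 e5 e6).elim
  · exact (a4 e4 e5 e6).elim
  · exact (a4 e4 e5 e6).elim
  · exact (a4 e4 e5 e6).elim
  · exact (a4 e4 e5 e6).elim
  · exact Or.inl ⟨(4, 6, 9), by decide, heights_intro (4, 6, 9) ⟨by rw [hx0]; rfl, by rw [hx1]; rfl, by rw [e2]; rfl, by rw [e3]; rfl, by rw [e4]; rfl, by rw [e5]; rfl, by rw [e6]; rfl, by rw [e7]; rfl, by rw [e8]; rfl, by rw [e9]; rfl, by rw [hx10]; rfl⟩⟩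
  · exact Or.inl ⟨(4, 6, 8), by decide, heights_intro (4, 6, 8) ⟨by rw [hx0]; rfl, by rw [hx1]; rfl, by rw [e2]; rfl, by rw [e3]; rfl, by rw [e4]; rfl, by rw [e5]; rfl, by rw [e6]; rfl, by rw [e7]; rfl, by rw [e8]; rfl, by rw [e9]; rfl, by rw [hx10]; rfl⟩⟩
  · exact (b6 e6 e7 e8).elim
  · exact (b6 e6 e7 e8).elim
  · exact Or.inl ⟨(4, 7, 9), by decide, heights_intro (4, 7, 9) ⟨by rw [hx0]; rfl, by rw [hx1]; rfl, by rw [e2]; rfl, by rw [e3]; rfl, by rw [e4]; rfl, by rw [e5]; rfl, by rw [e6]; rfl, by rw [e7]; rfl, by rw [e8]; rfl, by rw [e9]; rfl, by rw [hx10]; rfl⟩⟩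
  · exact (b7 e7 e8 e9).elim
  · exact (b8 e8 e9 hx10).elim
  · exact (nmono ⟨by norm_num [hx1, e2], by norm_num [e2, e3], by norm_num [e3, e4], by norm_num [e4, e5], by norm_num [e5, e6], by norm_num [e6, e7], by norm_num [e7, e8], by norm_num [e8, e9], by norm_num [e9, hx10]⟩).elim
  · exact (a3 e3 e4 e5).elim
  · exact (a3 e3 e4 e5).elim
  · exact (a3 e3 e4 e5).elim
  · exact (a3 e3 e4 e5).elim
  · exact (a3 e3 e4 e5).elim
  · exact (a3 e3 e4 e5).elim
  · exact (a3 e3 e4 e5).elim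
  · exact (a3 e3 e4 e5).elim
  · exact (a3 e3 e4 e5).elim
  · exact (a3 e3 e4 e5).elim
  · exact (a3 e3 e4 e5).elim
  · exact (a3 e3 e4 e5).elim
  · exact (a3 e3 e4 e5).elim
  · exact (a3 e3 e4 e5).elim
  · exact (a3 e3 e4 e5).elim
  · exact (a3 e3 e4 e5).elim
  · exact Or.inl ⟨(3, 5, 9), by decide, heights_intro (3, 5, 9) ⟨by rw [hx0]; rfl, by rw [hx1]; rfl, by rw [e2]; rfl, by rw [e3]; rfl, by rw [e4]; rfl, by rw [e5]; rfl, by rw [e6]; rfl, by rw [e7]; rfl, by rw [e8]; rfl, by rw [e9]; rfl, by rw [hx10]; rfl⟩⟩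
  · exact Or.inl ⟨(3, 5, 8), by decide, heights_intro (3, 5, 8) ⟨by rw [hx0]; rfl, by rw [hx1]; rfl, by rw [e2]; rfl, by rw [e3]; rfl, by rw [e4]; rfl, by rw [e5]; rfl, by rw [e6]; rfl, by rw [e7]; rfl, by rw [e8]; rfl, by rw [e9]; rfl, by rw [hx10]; rfl⟩⟩
  · exact (a7 e7 e8 e9).elim
  · exact Or.inl ⟨(3, 5, 7), by decide, heights_intro (3, 5, 7) ⟨by rw [hx0]; rfl, by rw [hx1]; rfl, by rw [e2]; rfl, by rw [e3]; rfl, by rw [e4]; rfl, by rw [e5]; rfl, by rw [e6]; rfl, by rw [e7]; rfl, by rw [e8]; rfl, by rw [e9]; rfl, by rw [hx10]; rfl⟩⟩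
  · exact (b5 e5 e6 e7).elim
  · exact (b5 e5 e6 e7).elim
  · exact (b5 e5 e6 e7).elim
  · exact (b5 e5 e6 e7).elim
  · exact Or.inl ⟨(3, 6, 9), by decide, heights_intro (3, 6, 9) ⟨by rw [hx0]; rfl, by rw [hx1]; rfl, by rw [e2]; rfl, by rw [e3]; rfl, by rw [e4]; rfl, by rw [e5]; rfl, by rw [e6]; rfl, by rw [e7]; rfl, by rw [e8]; rfl, by rw [e9]; rfl, by rw [hx10]; rfl⟩⟩
  · exact Or.inl ⟨(3, 6, 8), by decide, heights_intro (3, 6, 8) ⟨by rw [hx0]; rfl, by rw [hx1]; rfl, by rw [e2]; rfl, by rw [e3]; rfl, by rw [e4]; rfl, by rw [e5]; rfl, by rw [e6]; rfl, by rw [e7]; rfl, by rw [e8]; rfl, by rw [e9]; rfl, by rw [hx10]; rfl⟩⟩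
  · exact (b6 e6 e7 e8).elim
  · exact (b6 e6 e7 e8).elim
  · exact Or.inl ⟨(3, 7, 9), by decide, heights_intro (3, 7, 9) ⟨by rw [hx0]; rfl, by rw [hx1]; rfl, by rw [e2]; rfl, by rw [e3]; rfl, by rw [e4]; rfl, by rw [e5]; rfl, by rw [e6]; rfl, by rw [e7]; rfl, by rw [e8]; rfl, by rw [e9]; rfl, by rw [hx10]; rfl⟩⟩
  · exact (b7 e7 e8 e9).elim
  · exact (b8 e8 e9 hx10).elim
  · exact (nmono ⟨by norm_num [hx1, e2], by norm_num [e2, e3], by norm_num [e3, e4], by norm_num [e4, e5], by norm_num [e5, e6], by norm_num [e6, e7], by norm_num [e7, e8], by norm_num [e8, e9], by norm_num [e9, hx10]⟩).elim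
  · exact (a2 e2 e3 e4).elim
  · exact (a2 e2 e3 e4).elim
  · exact (a2 e2 e3 e4).elim
  · exact (a2 e2 e3 e4).elim
  · exact (a2 e2 e3 e4).elim
  · exact (a2 e2 e3 e4).elim
  · exact (a2 e2 e3 e4).elim
  · exact (a2 e2 e3 e4).elim
  · exact (a2 e2 e3 e4).elim
  · exact (a2 e2 e3 e4).elim
  · exact (a2 e2 e3 e4).elim
  · exact (a2 e2 e3 e4).elim
  · exact (a2 e2 e3 e4).elim
  · exact (a2 e2 e3 e4).elim
  · exact (a2 e2 e3 e4).elim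
  · exact (a2 e2 e3 e4).elim
  · exact (a2 e2 e3 e4).elim
  · exact (a2 e2 e3 e4).elim
  · exact (a2 e2 e3 e4).elim
  · exact (a2 e2 e3 e4).elim
  · exact (a2 e2 e3 e4).elim
  · exact (a2 e2 e3 e4).elim
  · exact (a2 e2 e3 e4).elim
  · exact (a2 e2 e3 e4).elim
  · exact (a2 e2 e3 e4).elim
  · exact (a2 e2 e3 e4).elim
  · exact (a2 e2 e3 e4).elim
  · exact (a2 e2 e3 e4).elim
  · exact (a2 e2 e3 e4).elim
  · exact (a2 e2 e3 e4).elim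
  · exact (a2 e2 e3 e4).elim
  · exact (a2 e2 e3 e4).elim
  · exact Or.inl ⟨(2, 4, 9), by decide, heights_intro (2, 4, 9) ⟨by rw [hx0]; rfl, by rw [hx1]; rfl, by rw [e2]; rfl, by rw [e3]; rfl, by rw [e4]; rfl, by rw [e5]; rfl, by rw [e6]; rfl, by rw [e7]; rfl, by rw [e8]; rfl, by rw [e9]; rfl, by rw [hx10]; rfl⟩⟩
  · exact Or.inl ⟨(2, 4, 8), by decide, heights_intro (2, 4, 8) ⟨by rw [hx0]; rfl, by rw [hx1]; rfl, by rw [e2]; rfl, by rw [e3]; rfl, by rw [e4]; rfl, by rw [e5]; rfl, by rw [e6]; rfl, by rw [e7]; rfl, by rw [e8]; rfl, by rw [e9]; rfl, by rw [hx10]; rfl⟩⟩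
  · exact (a7 e7 e8 e9).elim
  · exact Or.inl ⟨(2, 4, 7), by decide, heights_intro (2, 4, 7) ⟨by rw [hx0]; rfl, by rw [hx1]; rfl, by rw [e2]; rfl, by rw [e3]; rfl, by rw [e4]; rfl, by rw [e5]; rfl, by rw [e6]; rfl, by rw [e7]; rfl, by rw [e8]; rfl, by rw [e9]; rfl, by rw [hx10]; rfl⟩⟩
  · exact (a6 e6 e7 e8).elim
  · exact (a6 e6 e7 e8).elim
  · exact (b8 e8 e9 hx10).elim
  · exact Or.inl ⟨(2, 4, 6), by decide, heights_intro (2, 4, 6) ⟨by rw [hx0]; rfl, by rw [hx1]; rfl, by rw [e2]; rfl, by rw [e3]; rfl, by rw [e4]; rfl, by rw [e5]; rfl, by rw [e6]; rfl, by rw [e7]; rfl, by rw [e8]; rfl, by rw [e9]; rfl, by rw [hx10]; rfl⟩⟩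
  · exact (b4 e4 e5 e6).elim
  · exact (b4 e4 e5 e6).elim
  · exact (b4 e4 e5 e6).elim
  · exact (b4 e4 e5 e6).elim
  · exact (b4 e4 e5 e6).elim
  · exact (b4 e4 e5 e6).elim
  · exact (b4 e4 e5 e6).elim
  · exact (b4 e4 e5 e6).elim
  · exact Or.inl ⟨(2, 5, 9), by decide, heights_intro (2, 5, 9) ⟨by rw [hx0]; rfl, by rw [hx1]; rfl, by rw [e2]; rfl, by rw [e3]; rfl, by rw [e4]; rfl, by rw [e5]; rfl, by rw [e6]; rfl, by rw [e7]; rfl, by rw [e8]; rfl, by rw [e9]; rfl, by rw [hx10]; rfl⟩⟩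
  · exact Or.inl ⟨(2, 5, 8), by decide, heights_intro (2, 5, 8) ⟨by rw [hx0]; rfl, by rw [hx1]; rfl, by rw [e2]; rfl, by rw [e3]; rfl, by rw [e4]; rfl, by rw [e5]; rfl, by rw [e6]; rfl, by rw [e7]; rfl, by rw [e8]; rfl, by rw [e9]; rfl, by rw [hx10]; rfl⟩⟩
  · exact (a7 e7 e8 e9).elim
  · exact Or.inl ⟨(2, 5, 7), by decide, heights_intro (2, 5, 7) ⟨by rw [hx0]; rfl, by rw [hx1]; rfl, by rw [e2]; rfl, by rw [e3]; rfl, by rw [e4]; rfl, by rw [e5]; rfl, by rw [e6]; rfl, by rw [e7]; rfl, by rw [e8]; rfl, by rw [e9]; rfl, by rw [hx10]; rfl⟩⟩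
  · exact (b5 e5 e6 e7).elim
  · exact (b5 e5 e6 e7).elim
  · exact (b5 e5 e6 e7).elim
  · exact (b5 e5 e6 e7).elim
  · exact Or.inl ⟨(2, 6, 9), by decide, heights_intro (2, 6, 9) ⟨by rw [hx0]; rfl, by rw [hx1]; rfl, by rw [e2]; rfl, by rw [e3]; rfl, by rw [e4]; rfl, by rw [e5]; rfl, by rw [e6]; rfl, by rw [e7]; rfl, by rw [e8]; rfl, by rw [e9]; rfl, by rw [hx10]; rfl⟩⟩
  · exact Or.inl ⟨(2, 6, 8), by decide, heights_intro (2, 6, 8) ⟨by rw [hx0]; rfl, by rw [hx1]; rfl, by rw [e2]; rfl, by rw [e3]; rfl, by rw [e4]; rfl, by rw [e5]; rfl, by rw [e6]; rfl, by rw [e7]; rfl, by rw [e8]; rfl, by rw [e9]; rfl, by rw [hx10]; rfl⟩⟩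
  · exact (b6 e6 e7 e8).elim
  · exact (b6 e6 e7 e8).elim
  · exact Or.inl ⟨(2, 7, 9), by decide, heights_intro (2, 7, 9) ⟨by rw [hx0]; rfl, by rw [hx1]; rfl, by rw [e2]; rfl, by rw [e3]; rfl, by rw [e4]; rfl, by rw [e5]; rfl, by rw [e6]; rfl, by rw [e7]; rfl, by rw [e8]; rfl, by rw [e9]; rfl, by rw [hx10]; rfl⟩⟩
  · exact (b7 e7 e8 e9).elim
  · exact (b8 e8 e9 hx10).elim
  · exact (nmono ⟨by norm_num [hx1, e2], by norm_num [e2, e3], by norm_num [e3, e4], by norm_num [e4, e5], by norm_num [e5, e6], by norm_num [e6, e7], by norm_num [e7, e8], by norm_num [e8, e9], by norm_num [e9, hx10]⟩).elim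
  · exact (a1 hx1 e2 e3).elim
  · exact (a1 hx1 e2 e3).elim
  · exact (a1 hx1 e2 e3).elim
  · exact (a1 hx1 e2 e3).elim
  · exact (a1 hx1 e2 e3).elim
  · exact (a1 hx1 e2 e3).elim
  · exact (a1 hx1 e2 e3).elim
  · exact (a1 hx1 e2 e3).elim
  · exact (a1 hx1 e2 e3).elim
  · exact (a1 hx1 e2 e3).elim
  · exact (a1 hx1 e2 e3).elim
  · exact (a1 hx1 e2 e3).elim
  · exact (a1 hx1 e2 e3).elim
  · exact (a1 hx1 e2 e3).elim
  · exact (a1 hx1 e2 e3).elim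
  · exact (a1 hx1 e2 e3).elim
  · exact (a1 hx1 e2 e3).elim
  · exact (a1 hx1 e2 e3).elim
  · exact (a1 hx1 e2 e3).elim
  · exact (a1 hx1 e2 e3).elim
  · exact (a1 hx1 e2 e3).elim
  · exact (a1 hx1 e2 e3).elim
  · exact (a1 hx1 e2 e3).elim
  · exact (a1 hx1 e2 e3).elim
  · exact (a1 hx1 e2 e3).elim
  · exact (a1 hx1 e2 e3).elim
  · exact (a1 hx1 e2 e3).elim
  · exact (a1 hx1 e2 e3).elim
  · exact (a1 hx1 e2 e3).elim
  · exact (a1 hx1 e2 e3).elim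
  · exact (a1 hx1 e2 e3).elim
  · exact (a1 hx1 e2 e3).elim
  · exact (a1 hx1 e2 e3).elim
  · exact (a1 hx1 e2 e3).elim
  · exact (a1 hx1 e2 e3).elim
  · exact (a1 hx1 e2 e3).elim
  · exact (a1 hx1 e2 e3).elim
  · exact (a1 hx1 e2 e3).elim
  · exact (a1 hx1 e2 e3).elim
  · exact (a1 hx1 e2 e3).elim
  · exact (a1 hx1 e2 e3).elim
  · exact (a1 hx1 e2 e3).elim
  · exact (a1 hx1 e2 e3).elim
  · exact (a1 hx1 e2 e3).elim
  · exact (a1 hx1 e2 e3).elim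
  · exact (a1 hx1 e2 e3).elim
  · exact (a1 hx1 e2 e3).elim
  · exact (a1 hx1 e2 e3).elim
  · exact (a1 hx1 e2 e3).elim
  · exact (a1 hx1 e2 e3).elim
  · exact (a1 hx1 e2 e3).elim
  · exact (a1 hx1 e2 e3).elim
  · exact (a1 hx1 e2 e3).elim
  · exact (a1 hx1 e2 e3).elim
  · exact (a1 hx1 e2 e3).elim
  · exact (a1 hx1 e2 e3).elim
  · exact (a1 hx1 e2 e3).elim
  · exact (a1 hx1 e2 e3).elim
  · exact (a1 hx1 e2 e3).elim
  · exact (a1 hx1 e2 e3).elim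
  · exact (a1 hx1 e2 e3).elim
  · exact (a1 hx1 e2 e3).elim
  · exact (a1 hx1 e2 e3).elim
  · exact (a1 hx1 e2 e3).elim
  · exact Or.inl ⟨(1, 3, 9), by decide, heights_intro (1, 3, 9) ⟨by rw [hx0]; rfl, by rw [hx1]; rfl, by rw [e2]; rfl, by rw [e3]; rfl, by rw [e4]; rfl, by rw [e5]; rfl, by rw [e6]; rfl, by rw [e7]; rfl, by rw [e8]; rfl, by rw [e9]; rfl, by rw [hx10]; rfl⟩⟩
  · exact Or.inl ⟨(1, 3, 8), by decide, heights_intro (1, 3, 8) ⟨by rw [hx0]; rfl, by rw [hx1]; rfl, by rw [e2]; rfl, by rw [e3]; rfl, by rw [e4]; rfl, by rw [e5]; rfl, by rw [e6]; rfl, by rw [e7]; rfl, by rw [e8]; rfl, by rw [e9]; rfl, by rw [hx10]; rfl⟩⟩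
  · exact (a7 e7 e8 e9).elim
  · exact Or.inl ⟨(1, 3, 7), by decide, heights_intro (1, 3, 7) ⟨by rw [hx0]; rfl, by rw [hx1]; rfl, by rw [e2]; rfl, by rw [e3]; rfl, by rw [e4]; rfl, by rw [e5]; rfl, by rw [e6]; rfl, by rw [e7]; rfl, by rw [e8]; rfl, by rw [e9]; rfl, by rw [hx10]; rfl⟩⟩
  · exact (a6 e6 e7 e8).elim
  · exact (a6 e6 e7 e8).elim
  · exact (b8 e8 e9 hx10).elim
  · exact Or.inl ⟨(1, 3, 6), by decide, heights_intro (1, 3, 6) ⟨by rw [hx0]; rfl, by rw [hx1]; rfl, by rw [e2]; rfl, by rw [e3]; rfl, by rw [e4]; rfl, by rw [e5]; rfl, by rw [e6]; rfl, by rw [e7]; rfl, by rw [e8]; rfl, by rw [e9]; rfl, by rw [hx10]; rfl⟩⟩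
  · exact (a5 e5 e6 e7).elim
  · exact (a5 e5 e6 e7).elim
  · exact (a5 e5 e6 e7).elim
  · exact (a5 e5 e6 e7).elim
  · exact Or.inr (heightsB_intro ⟨by rw [hx0]; rfl, by rw [hx1]; rfl, by rw [e2]; rfl, by rw [e3]; rfl, by rw [e4]; rfl, by rw [e5]; rfl, by rw [e6]; rfl, by rw [e7]; rfl, by rw [e8]; rfl, by rw [e9]; rfl, by rw [hx10]; rfl⟩)
  · exact (b7 e7 e8 e9).elim
  · exact (b8 e8 e9 hx10).elim
  · exact Or.inl ⟨(1, 3, 5), by decide, heights_intro (1, 3, 5) ⟨by rw [hx0]; rfl, by rw [hx1]; rfl, by rw [e2]; rfl, by rw [e3]; rfl, by rw [e4]; rfl, by rw [e5]; rfl, by rw [e6]; rfl, by rw [e7]; rfl, by rw [e8]; rfl, by rw [e9]; rfl, by rw [hx10]; rfl⟩⟩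
  · exact (b3 e3 e4 e5).elim
  · exact (b3 e3 e4 e5).elim
  · exact (b3 e3 e4 e5).elim
  · exact (b3 e3 e4 e5).elim
  · exact (b3 e3 e4 e5).elim
  · exact (b3 e3 e4 e5).elim
  · exact (b3 e3 e4 e5).elim
  · exact (b3 e3 e4 e5).elim
  · exact (b3 e3 e4 e5).elim
  · exact (b3 e3 e4 e5).elim
  · exact (b3 e3 e4 e5).elim
  · exact (b3 e3 e4 e5).elim
  · exact (b3 e3 e4 e5).elim
  · exact (b3 e3 e4 e5).elim
  · exact (b3 e3 e4 e5).elim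
  · exact (b3 e3 e4 e5).elim
  · exact Or.inl ⟨(1, 4, 9), by decide, heights_intro (1, 4, 9) ⟨by rw [hx0]; rfl, by rw [hx1]; rfl, by rw [e2]; rfl, by rw [e3]; rfl, by rw [e4]; rfl, by rw [e5]; rfl, by rw [e6]; rfl, by rw [e7]; rfl, by rw [e8]; rfl, by rw [e9]; rfl, by rw [hx10]; rfl⟩⟩
  · exact Or.inl ⟨(1, 4, 8), by decide, heights_intro (1, 4, 8) ⟨by rw [hx0]; rfl, by rw [hx1]; rfl, by rw [e2]; rfl, by rw [e3]; rfl, by rw [e4]; rfl, by rw [e5]; rfl, by rw [e6]; rfl, by rw [e7]; rfl, by rw [e8]; rfl, by rw [e9]; rfl, by rw [hx10]; rfl⟩⟩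
  · exact (a7 e7 e8 e9).elim
  · exact Or.inl ⟨(1, 4, 7), by decide, heights_intro (1, 4, 7) ⟨by rw [hx0]; rfl, by rw [hx1]; rfl, by rw [e2]; rfl, by rw [e3]; rfl, by rw [e4]; rfl, by rw [e5]; rfl, by rw [e6]; rfl, by rw [e7]; rfl, by rw [e8]; rfl, by rw [e9]; rfl, by rw [hx10]; rfl⟩⟩
  · exact (a6 e6 e7 e8).elim
  · exact (a6 e6 e7 e8).elim
  · exact (b8 e8 e9 hx10).elim
  · exact Or.inl ⟨(1, 4, 6), by decide, heights_intro (1, 4, 6) ⟨by rw [hx0]; rfl, by rw [hx1]; rfl, by rw [e2]; rfl, by rw [e3]; rfl, by rw [e4]; rfl, by rw [e5]; rfl, by rw [e6]; rfl, by rw [e7]; rfl, by rw [e8]; rfl, by rw [e9]; rfl, by rw [hx10]; rfl⟩⟩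
  · exact (b4 e4 e5 e6).elim
  · exact (b4 e4 e5 e6).elim
  · exact (b4 e4 e5 e6).elim
  · exact (b4 e4 e5 e6).elim
  · exact (b4 e4 e5 e6).elim
  · exact (b4 e4 e5 e6).elim
  · exact (b4 e4 e5 e6).elim
  · exact (b4 e4 e5 e6).elim
  · exact Or.inl ⟨(1, 5, 9), by decide, heights_intro (1, 5, 9) ⟨by rw [hx0]; rfl, by rw [hx1]; rfl, by rw [e2]; rfl, by rw [e3]; rfl, by rw [e4]; rfl, by rw [e5]; rfl, by rw [e6]; rfl, by rw [e7]; rfl, by rw [e8]; rfl, by rw [e9]; rfl, by rw [hx10]; rfl⟩⟩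
  · exact Or.inl ⟨(1, 5, 8), by decide, heights_intro (1, 5, 8) ⟨by rw [hx0]; rfl, by rw [hx1]; rfl, by rw [e2]; rfl, by rw [e3]; rfl, by rw [e4]; rfl, by rw [e5]; rfl, by rw [e6]; rfl, by rw [e7]; rfl, by rw [e8]; rfl, by rw [e9]; rfl, by rw [hx10]; rfl⟩⟩
  · exact (a7 e7 e8 e9).elim
  · exact Or.inl ⟨(1, 5, 7), by decide, heights_intro (1, 5, 7) ⟨by rw [hx0]; rfl, by rw [hx1]; rfl, by rw [e2]; rfl, by rw [e3]; rfl, by rw [e4]; rfl, by rw [e5]; rfl, by rw [e6]; rfl, by rw [e7]; rfl, by rw [e8]; rfl, by rw [e9]; rfl, by rw [hx10]; rfl⟩⟩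
  · exact (b5 e5 e6 e7).elim
  · exact (b5 e5 e6 e7).elim
  · exact (b5 e5 e6 e7).elim
  · exact (b5 e5 e6 e7).elim
  · exact Or.inl ⟨(1, 6, 9), by decide, heights_intro (1, 6, 9) ⟨by rw [hx0]; rfl, by rw [hx1]; rfl, by rw [e2]; rfl, by rw [e3]; rfl, by rw [e4]; rfl, by rw [e5]; rfl, by rw [e6]; rfl, by rw [e7]; rfl, by rw [e8]; rfl, by rw [e9]; rfl, by rw [hx10]; rfl⟩⟩
  · exact Or.inl ⟨(1, 6, 8), by decide, heights_intro (1, 6, 8) ⟨by rw [hx0]; rfl, by rw [hx1]; rfl, by rw [e2]; rfl, by rw [e3]; rfl, by rw [e4]; rfl, by rw [e5]; rfl, by rw [e6]; rfl, by rw [e7]; rfl, by rw [e8]; rfl, by rw [e9]; rfl, by rw [hx10]; rfl⟩⟩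
  · exact (b6 e6 e7 e8).elim
  · exact (b6 e6 e7 e8).elim
  · exact Or.inl ⟨(1, 7, 9), by decide, heights_intro (1, 7, 9) ⟨by rw [hx0]; rfl, by rw [hx1]; rfl, by rw [e2]; rfl, by rw [e3]; rfl, by rw [e4]; rfl, by rw [e5]; rfl, by rw [e6]; rfl, by rw [e7]; rfl, by rw [e8]; rfl, by rw [e9]; rfl, by rw [hx10]; rfl⟩⟩
  · exact (b7 e7 e8 e9).elim
  · exact (b8 e8 e9 hx10).elim
  · exact (nmono ⟨by norm_num [hx1, e2], by norm_num [e2, e3], by norm_num [e3, e4], by norm_num [e4, e5], by norm_num [e5, e6], by norm_num [e6, e7], by norm_num [e7, e8], by norm_num [e8, e9], by norm_num [e9, hx10]⟩).elim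

/-- ★ **Every cost-eight irreducible bridge of `ℤ^{d+1}` of length ten is `walk v u` (shape A, `v ∈ verts`, `u ∈ adm v`) or `walkB w`
(shape B, `w ∈ admB`).** [cite: MadrasSlade1993, §4.2, remark after Theorem 4.2.4 (p. 94)] -/
theorem exists_params_of_mem {ω : ℕ → Site (d + 1)}
    (hω : ω ∈ (irreducibleBridges (d + 1) 10).filter fun ω => costZd d 10 ω = 8) :
    (∃ v, IsVert v ∧ ∃ u ∈ adm d v, walk d v u = ω) ∨ (∃ w ∈ admB d, walkB d w = ω) := by
  obtain ⟨hirr, -⟩ := Finset.mem_filter.1 hω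
  obtain ⟨hbr, -⟩ := mem_irreducibleBridges.1 hirr
  obtain ⟨hωs, -⟩ := mem_bridges.1 hbr
  rcases exists_shape_of_mem hω with ⟨v, hv, hH⟩ | hH
  · obtain ⟨u, hu⟩ := exists_eq_walk_of_heights hv hωs hH
    exact Or.inl ⟨v, hv, u, (mem_adm_iff hv).2 (hu ▸ hωs), hu.symm⟩
  · obtain ⟨w, hw⟩ := exists_eq_walkB_of_heights hωs hH
    exact Or.inr ⟨w, mem_admB_iff.2 (hw ▸ hωs), hw.symm⟩

end converse

/-! ### The layer as a disjoint union -/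

/-- The thirty-five admissible vertical-time triples. [cite: MadrasSlade1993, §4.2, remark after Theorem 4.2.4 (p. 94)] -/
def verts : Finset (ℕ × ℕ × ℕ) := ((Finset.range 6 ×ˢ (Finset.range 8 ×ˢ Finset.range 10))).filter IsVert

/-- Membership in `verts`. [cite: MadrasSlade1993, §4.2, remark after Theorem 4.2.4 (p. 94)] -/
theorem mem_verts {v : ℕ × ℕ × ℕ} : v ∈ verts ↔ IsVert v := by
  obtain ⟨p, q, r⟩ := v
  simp only [verts, Finset.mem_filter, Finset.mem_product, Finset.mem_range, IsVert]
  omega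

/-- The thirty-five triples, listed. [cite: MadrasSlade1993, §4.2, remark after Theorem 4.2.4 (p. 94)] -/
theorem verts_eq : verts = {(1, 3, 5), (1, 3, 6), (1, 3, 7), (1, 3, 8), (1, 3, 9), (1, 4, 6), (1, 4, 7), (1, 4, 8), (1, 4, 9), (1, 5, 7), (1, 5, 8), (1, 5, 9), (1, 6, 8), (1, 6, 9), (1, 7, 9), (2, 4, 6), (2, 4, 7), (2, 4, 8), (2, 4, 9), (2, 5, 7), (2, 5, 8), (2, 5, 9), (2, 6, 8), (2, 6, 9), (2, 7, 9), (3, 5, 7), (3, 5, 8), (3, 5, 9), (3, 6, 8), (3, 6, 9), (3, 7, 9), (4, 6, 8), (4, 6, 9), (4, 7, 9), (5, 7, 9)} := by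
  decide

section union

variable {d : ℕ}

/-- Shape (A) and shape (B) walks never coincide (their height profiles differ). [cite: MadrasSlade1993, §4.2, remark after Theorem 4.2.4 (p. 94)] -/
theorem walk_ne_walkB {v : ℕ × ℕ × ℕ} (hv : IsVert v) (u : W6 d) (w : W4 d) : walk d v u ≠ walkB d w := by
  intro h
  have hH : ∀ t, t ≤ 10 → ht v t = htB t := by
    intro t ht
    have := congrFun (congrFun h t) 0
    rw [walk_apply_zero, walkB_apply_zero, min_eq_left ht] at this
    exact_mod_cast this
  have htwo : ∀ t, 1 ≤ t → ht v t = 2 → (v.1 < t ∧ t ≤ v.2.1) ∨ v.2.2 < t := by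
    intro t ht1 h; simp only [ht] at h; split_ifs at h <;> omega
  have hone : ∀ t, 1 ≤ t → ht v t = 1 → t ≤ v.1 ∨ (v.2.1 < t ∧ t ≤ v.2.2) := by
    intro t ht1 h; simp only [ht] at h; split_ifs at h <;> omega
  obtain ⟨h1, h2, h3, h4⟩ := hv
  have e3 := htwo 3 (by norm_num) (by rw [hH 3 (by norm_num)]; decide)
  have e4 := hone 4 (by norm_num) (by rw [hH 4 (by norm_num)]; decide)
  have e6 := htwo 6 (by norm_num) (by rw [hH 6 (by norm_num)]; decide)
  have e8 := hone 8 (by norm_num) (by rw [hH 8 (by norm_num)]; decide)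
  omega

/-- ★ The cost-eight irreducible bridges of length ten: the disjoint union of the thirty-five shape-(A) families and the shape-(B) family.
[cite: MadrasSlade1993, §4.2, remark after Theorem 4.2.4 (p. 94)] -/
theorem layer_eq_union (d : ℕ) [DecidableEq (ℕ → Site (d + 1))] :
    ((irreducibleBridges (d + 1) 10).filter fun ω => costZd d 10 ω = 8) =
      verts.biUnion (fun v => (adm d v).image (walk d v)) ∪ (admB d).image (walkB d) := by
  ext ω
  simp only [Finset.mem_union, Finset.mem_biUnion, Finset.mem_image]
  constructor
  · intro h
    rcases exists_params_of_mem h with ⟨v, hv, u, hu, rfl⟩ | ⟨w, hw, rfl⟩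
    · exact Or.inl ⟨v, mem_verts.2 hv, u, hu, rfl⟩
    · exact Or.inr ⟨w, hw, rfl⟩
  · rintro (⟨v, hv, u, hu, rfl⟩ | ⟨w, hw, rfl⟩)
    · exact walk_mem_filter (mem_verts.1 hv) ((mem_adm_iff (mem_verts.1 hv)).1 hu)
    · exact walkB_mem_filter (mem_admB_iff.1 hw)

/-- ★★ **The four-slack layer at span two as a sum of fibres**: `N_{8,10}(ℤ^{d+1}) = Σ_{v ∈ verts} #adm(v) + (2d(2d−1)³ − 2d(2d−2))`
(thirty-five six-letter fibres plus the four-step self-avoiding walks of the shape-(B) word).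
[cite: MadrasSlade1993, §4.2, remark after Theorem 4.2.4 (p. 94)] -/
theorem costCoeffZd_eight_ten_eq_sum (d : ℕ) :
    costCoeffZd d 8 10 = ∑ v ∈ verts, (adm d v).card + (2 * d * (2 * d - 1) ^ 3 - 2 * d * (2 * d - 2)) := by
  classical
  have hpair : (verts : Set (ℕ × ℕ × ℕ)).PairwiseDisjoint (fun v => (adm d v).image (walk d v)) := by
    intro v hv v' hv' hne
    simp only [Function.onFun]
    rw [Finset.disjoint_left]
    intro ω hω hω'
    obtain ⟨u, -, rfl⟩ := Finset.mem_image.1 hω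
    obtain ⟨u', -, h'⟩ := Finset.mem_image.1 hω'
    exact hne (verts_eq_of_eq (mem_verts.1 (Finset.mem_coe.1 hv)) (mem_verts.1 (Finset.mem_coe.1 hv')) h'.symm)
  have hdisj : Disjoint (verts.biUnion fun v => (adm d v).image (walk d v)) ((admB d).image (walkB d)) := by
    rw [Finset.disjoint_left]
    intro ω hω hω'
    obtain ⟨v, hv, hω⟩ := Finset.mem_biUnion.1 hω
    obtain ⟨u, -, rfl⟩ := Finset.mem_image.1 hω
    obtain ⟨w, -, hw⟩ := Finset.mem_image.1 hω'
    exact walk_ne_walkB (mem_verts.1 hv) u w hw.symm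
  have hsum : ∑ v ∈ verts, ((adm d v).image (walk d v)).card = ∑ v ∈ verts, (adm d v).card :=
    Finset.sum_congr rfl fun v hv => Finset.card_image_of_injective _ (walk_injective (mem_verts.1 hv))
  rw [costCoeffZd, layer_eq_union d, Finset.card_union_of_disjoint hdisj, Finset.card_biUnion hpair, hsum,
    Finset.card_image_of_injective _ (walkB_injective (d := d)), card_admB]

end union

end FourSlackTwo

end Literature.Probability.RandomPlanarGeometry.SAW.Zd

end
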